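import Literature.Barriers.AtomisticToContinuum.OneDimensionalHardCoreNarrow
import Literature.Analysis.Toeplitz.StrongSzegoProofs
import Literature.Analysis.Potential.CircleLogKernel
import Mathlib.Analysis.SpecialFunctions.Trigonometric.Bounds
import Mathlib.Analysis.SpecialFunctions.Integrals.Basic
import HarnessLib

/-!
# Lenard's Toeplitz formula and the Szegő–Lenard `√N` bound for the Girardeau gas

`Literature/Barriers/AtomisticToContinuum` (D-0021 barrier catalogue, conjunct
`BoseEinsteinCondensation`). Companion of `OneDimensionalHardCore.lean` (statement file: the
explicit Girardeau state `girardeauState`, its one-body density matrix `girardeauDensityMatrix`,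
the zero-momentum occupation `zeroMomentumOccupation N L = c₀(N)`, the proved `o(N)` fact
`OneDimensionalHardCore` and the typed sharp law `OneDimensionalHardCoreSqrt`:
`c₀(N)/√N → C > 0`), of `OneDimensionalHardCoreProofs.lean` (`OneDimensionalHardCore_holds`) and
`OneDimensionalHardCoreNarrow.lean` (scale invariance `c₀(N, L) = c₀(N, 1)`).

This file proves, sorry-free, the two classical EXACT inputs of the printed `√N` law and its
ORDER half — everything in the printed proof of Dyson's constant
[ClaeysKrasovsky2015, §1 (Lrho)–(LDy)] except the pointwise Fisher–Hartwig asymptotics of the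
Toeplitz determinant (Widom 1973), which is not in the tree:

1. **Lenard's formula** (Lenard 1964, "also obtained independently by Dyson"): the density matrix
   of `n + 1` impenetrable bosons is an `n × n` Toeplitz determinant,
   `ρ_{n+1}(a, b) = L⁻¹ D_n(f_{α,β})`, `f_{α,β}(θ) = |e^{iθ} - e^{iα}| |e^{iθ} - e^{iβ}|`,
   `α = 2πa/L`, `β = 2πb/L` (`density_eq_toeplitzDet`, `girardeauDensityMatrix_eq_lenardDet`);
   hence `c₀(n+1) = (2π)⁻¹ ∫₀^{2π} R(n, t) dt` with `R(n, t) = D_n(f_{t,0})`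
   (`zeroMomentumOccupation_succ_eq_integral`) [ClaeysKrasovsky2015, §1 (Lrho), (LdefR), (Ldet),
   (Lrho0)], [DeiftItsKrasovsky2013, Remark 8 (34p3), (r34-1)]. Proof: the Girardeau state is the
   modulus of a Vandermonde determinant (`girardeauState_eq_norm_det` of the Proofs file), so
   `ψ(X,a)ψ(X,b) = ((n+1)! L^{n+1})⁻¹ |Δ(X)|² ∏_j f(x_j)` with the NON-NEGATIVE symbol `f` (no sign
   trick), and Andréief's identity (`integral_det_mul_det`, ibid.) turns the box integral into
   `n! det[L (f_{α,β})_{k-j}]`; the `[0, L] → [-π, π]` substitution is one-dimensional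
   (`setIntegral_weight_mul_ez`).
2. **Szegő's inequality** (letter to Lenard of 10 July 1963, `|R_N(t)| ≤ |eN/sin(t/2)|^{1/2}`;
   published in Lenard 1964 and generalised in [Lenard1972, Theorem, eq. (29)]), here in the form
   `R(n, t) ≤ 2e √(n+1) / √|sin(t/2)|` (`lenardDet_le_sqrt`). Proof = Szegő's argument as printed
   in [Lenard1972, eqs. (13)–(29)]: dominate `f` by the Poisson-regularised symbol
   `|1 - r e^{i(θ-α)}| |1 - r e^{i(θ-β)}| / r` (`norm_lenardPoly_le_norm_regPoly`, from
   `|1 - r e^{iv}|² = (1-r)² + r |1 - e^{iv}|²`), use monotonicity of `D_n` in a non-negative symbol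
   (`toeplitzDet_norm_re_mono`, Heine–Andréief) and the strong Szegő INEQUALITY
   `D_n(e^h) ≤ e^{n h₀} exp(∑_{k≥1} k|h_k|²)` of the tree (`logSzego_le_szegoSum_of_geometric`,
   `Literature.Analysis.Toeplitz.StrongSzegoProofs`); the Szegő data of `h = log` of the regularised
   symbol are computed exactly from the Fourier expansion `log|1 - r e^{iv}| = -∑ r^m cos(mv)/m`
   (`Literature.Analysis.Potential.hasSum_circleLogKernelR`): `h₀ = -log r`,
   `∑ k|h_k|² = -½ log(1-r²) - ½ log|1 - r² e^{it}|` (`symbolMean_regLog`, `szegoSum_regLog_symm`),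
   and `r = (n+1)/(n+2)` gives the displayed bound.
3. **The `√N` law, upper bound**: integrating 2 against `√π t^{-1/2}` (Jordan's inequality),
   `∫₀^{2π} R(n, t) dt ≤ 8πe √(n+1)` and `c₀(N) ≤ 4e √N` for ALL `N` and `L`
   (`zeroMomentumOccupation_le_sqrt`, `oneDimensionalHardCore_sqrt_upper`) — Lenard's
   "`λ_max/N = O(N^{-1/2})`" [DeiftItsKrasovsky2013, Remark 8 (r34-1)–(r34-2)],
   [ClaeysKrasovsky2015, §1 after (Lrho0)], sharpening the tree's `o(N)` theorem
   `OneDimensionalHardCore_holds` to the printed order.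

4. **Dyson's constant modulo Fisher–Hartwig** (`oneDimensionalHardCoreSqrt_of_fisherHartwig`):
   by 2 the functions `R(N-1, t)/√N` have the integrable majorant
   `2e√π (t^{-1/2} + (2π-t)^{-1/2})` on `(0, 2π)` (`lenardDet_div_sqrt_le_sqrtBound`), so by
   dominated convergence `c₀(N)/√N → C = (2π)⁻¹ ∫₀^{2π} E |e^{it} - 1|^{-1/2} dt > 0` — the typed
   sharp law `OneDimensionalHardCoreSqrt` — AS SOON AS the POINTWISE limit
   `D_n(f_{θ₁,θ₂})/√n → E |e^{iθ₁} - e^{iθ₂}|^{-1/2}` (`E > 0`) is available. That limit is the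
   Fisher–Hartwig asymptotics for two zero-type singularities with `α₁ = α₂ = 1/2`
   (`E = G(3/2)⁴ ≈ 1.3069`) [Widom1973], [DeiftItsKrasovsky2013, §6 (eq81), (eq83)–(eq85)],
   conjectured in [Lenard1972, (53)] and proved there only for antipodal zeros (`t = π`, Jacobi
   polynomials); it is NOT in the tree and is taken as the hypothesis `hFH` of the theorem (stated
   with the tree's `toeplitzDet`/`circleCoeff`, constant existential). [ClaeysKrasovsky2015, Thm 1.6
   and Remark 10] refine it by uniform asymptotics in the merging window `t ≲ ω(n)/n`, which the
   dominated-convergence argument does not need for the leading constant. With `hFH` proved,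
   `OneDimensionalHardCoreSqrt_holds` is the one-line corollary.

## References

* [Lenard1972] A. Lenard, *Some remarks on large Toeplitz determinants*, Pacific J. Math. 42
  (1972) 137–145: eqs. (9)–(10) (Szegő's inequality `D_n < C n^{1/2} G^{n+1}` for the symbol (9)),
  (13)–(29) (the regularisation argument and the Theorem), (31)–(52) (antipodal zeros via Jacobi
  polynomials), (53) (the conjecture).
* [DeiftItsKrasovsky2013] P. Deift, A. Its, I. Krasovsky, Comm. Pure Appl. Math. 66 (2013)
  1360–1438, arXiv:1207.4990: §6 (eq81), (eq84)–(eq85); Remark 8 ((34p3) `R_N = D_{N-1}(f_t)`,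
  (r34-1), (r34-2) Szegő's bound, the Lenard–Szegő correspondence).
* [ClaeysKrasovsky2015] T. Claeys, I. Krasovsky, Duke Math. J. 164 (2015) 2897–2987,
  arXiv:1403.3639: §1 (Lrho), (LdefR), (Ldet), (Lrho0), (LDy); Thm 1.6 and Remark 10.
* [Widom1973] H. Widom, Amer. J. Math. 95 (1973) 333–383 (the pointwise asymptotics; not
  formalised).

## Design notes

All new general-purpose lemmas about Toeplitz determinants (`toeplitzDet_norm_re_mono`,
`toeplitzDet_const_mul`, `continuous_toeplitzDet_param`, `circleCoeff_circleLogKernelR`, …) are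
kept in the namespace `Literature.Barriers.AtomisticToContinuum.BoseGas` of this story (they use
only the public API of `Literature.Analysis.Toeplitz` and `Literature.Analysis.Potential`); no
statement or definition of the statement file is changed and no named fact is introduced.
-/

noncomputable section

open MeasureTheory Filter Topology Finset Complex Matrix
open Literature.Analysis.Toeplitz Literature.Analysis.Potential
open scoped BigOperators Real ComplexConjugate

namespace Literature.Barriers.AtomisticToContinuum.BoseGas

/-! ### Lenard's symbol -/

section Symbol

/-- **Lenard's symbol**: the non-negative function of the angle
`f_{α,β}(θ) = |e^{iθ} - e^{iα}| |e^{iθ} - e^{iβ}|` with zeros at `e^{iα}`, `e^{iβ}` (two Fisher–Hartwig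
zero-type singularities with `α₁ = α₂ = 1/2`), as a complex-valued symbol.
[cite: DeiftItsKrasovsky2013, §6 (eq81) and Remark 8 (Lensym)] -/
def lenardSymbol (α β θ : ℝ) : ℂ :=
  ((‖(cexp (θ * I) - cexp (α * I)) * (cexp (θ * I) - cexp (β * I))‖ : ℝ) : ℂ)

/-- The polynomial `(z - e^{iα})(z - e^{iβ})` on the circle whose modulus is Lenard's symbol.
[folklore] -/
def lenardPoly (α β θ : ℝ) : ℂ := (cexp (θ * I) - cexp (α * I)) * (cexp (θ * I) - cexp (β * I))

/-- `f_{α,β} = |p_{α,β}|`. [folklore] -/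
theorem lenardSymbol_eq_norm (α β : ℝ) :
    lenardSymbol α β = fun θ => ((‖lenardPoly α β θ‖ : ℝ) : ℂ) := rfl

/-- The polynomial is jointly continuous in `(α, θ)` for fixed `β`. [folklore] -/
theorem continuous_lenardPoly_uncurry (β : ℝ) :
    Continuous (Function.uncurry fun α θ => lenardPoly α β θ) := by
  unfold lenardPoly; fun_prop

/-- Lenard's symbol is continuous in the angle. [folklore] -/
theorem continuous_lenardSymbol (α β : ℝ) : Continuous (lenardSymbol α β) := by
  unfold lenardSymbol; fun_prop

/-- Lenard's symbol is jointly continuous in `(α, θ)`. [folklore] -/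
theorem continuous_lenardSymbol_uncurry (β : ℝ) :
    Continuous (Function.uncurry fun α θ => lenardSymbol α β θ) := by
  unfold lenardSymbol; fun_prop

/-- `e^{i(θ + 2π)} = e^{iθ}`. [folklore] -/
theorem cexp_add_two_pi_mul_I (θ : ℝ) : cexp (↑(θ + 2 * π) * I) = cexp (θ * I) := by
  rw [show (↑(θ + 2 * π) : ℂ) * I = θ * I + 2 * π * I by push_cast; ring, Complex.exp_add,
    Complex.exp_two_pi_mul_I, mul_one]

/-- Lenard's symbol is `2π`-periodic in the angle. [folklore] -/
theorem lenardSymbol_periodic (α β : ℝ) : Function.Periodic (lenardSymbol α β) (2 * π) := by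
  intro θ
  simp only [lenardSymbol, cexp_add_two_pi_mul_I]

/-- Lenard's symbol is `2π`-periodic in the position of the first zero. [folklore] -/
theorem lenardSymbol_add_two_pi_left (α β θ : ℝ) :
    lenardSymbol (α + 2 * π) β θ = lenardSymbol α β θ := by
  simp only [lenardSymbol, cexp_add_two_pi_mul_I]

/-- Lenard's symbol is symmetric in its two zeros. [folklore] -/
theorem lenardSymbol_comm (α β θ : ℝ) : lenardSymbol α β θ = lenardSymbol β α θ := by
  simp only [lenardSymbol, mul_comm]

/-- **Rotation covariance**: `f_{α,β}(θ) = f_{α-s,β-s}(θ - s)`. [folklore] -/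
theorem lenardSymbol_sub (α β s θ : ℝ) :
    lenardSymbol (α - s) (β - s) (θ - s) = lenardSymbol α β θ := by
  have key : ∀ u : ℝ, cexp (↑(u - s) * I) = cexp (u * I) * cexp (-(s * I)) := by
    intro u
    rw [← Complex.exp_add]
    congr 1
    push_cast
    ring
  have hn : ‖cexp (-(s * I))‖ = 1 := by
    rw [show -((s : ℂ) * I) = ((-s : ℝ) : ℂ) * I by push_cast; ring]
    exact norm_exp_ofReal_mul_I _
  simp only [lenardSymbol, key, ← sub_mul, norm_mul, hn, mul_one]

/-- Lenard's symbol is real and non-negative: `f = |p|`. [folklore] -/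
theorem lenardSymbol_eq_ofReal (α β θ : ℝ) :
    lenardSymbol α β θ = ((‖cexp (θ * I) - cexp (α * I)‖ * ‖cexp (θ * I) - cexp (β * I)‖ : ℝ) : ℂ) := by
  rw [lenardSymbol, norm_mul]

/-- `|f_{α,β}(θ)| ≤ 4`. [folklore] -/
theorem norm_lenardPoly_le (α β θ : ℝ) : ‖lenardPoly α β θ‖ ≤ 4 := by
  unfold lenardPoly
  rw [norm_mul]
  have h : ∀ u v : ℝ, ‖cexp (u * I) - cexp (v * I)‖ ≤ 2 := fun u v =>
    (norm_sub_le _ _).trans (by rw [norm_exp_ofReal_mul_I, norm_exp_ofReal_mul_I]; norm_num)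
  calc ‖cexp (θ * I) - cexp (α * I)‖ * ‖cexp (θ * I) - cexp (β * I)‖ ≤ 2 * 2 :=
        mul_le_mul (h _ _) (h _ _) (norm_nonneg _) zero_le_two
    _ = 4 := by norm_num

end Symbol

/-! ### Toeplitz determinants of non-negative symbols: monotonicity, scaling, continuity -/

section ToeplitzTools

/-- **Monotonicity of Toeplitz determinants in a non-negative symbol** (Heine–Andréief):
`|f| ≤ |g|` pointwise implies `D_n(|f|) ≤ D_n(|g|)`. [cite: Lenard1972, eq. (15) ("the Toeplitz
determinants depend monotonically on the generating function")] -/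
theorem toeplitzDet_norm_re_mono {f g : ℝ → ℂ} (hf : Continuous f) (hg : Continuous g)
    (hle : ∀ θ, ‖f θ‖ ≤ ‖g θ‖) (n : ℕ) :
    (toeplitzDet (circleCoeff fun θ => (‖f θ‖ : ℂ)) n).re ≤
      (toeplitzDet (circleCoeff fun θ => (‖g θ‖ : ℂ)) n).re := by
  have hK := heineConst_pos n
  have hf' := toeplitzDet_norm_symbol_mul_eq hf n
  have hg' := toeplitzDet_norm_symbol_mul_eq hg n
  rw [← heineConst_cast] at hf' hg'
  have hre : ∀ {φ : ℝ → ℂ}, toeplitzDet (circleCoeff fun θ => (‖φ θ‖ : ℂ)) n *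
      ((((2 * π) ^ n * (n.factorial : ℝ) : ℝ)) : ℂ) =
      ((∫ θ, (∏ i, ‖φ (θ i)‖) * ‖vandI n θ‖ ^ 2 ∂(torusMeasure n) : ℝ) : ℂ) →
      (toeplitzDet (circleCoeff fun θ => (‖φ θ‖ : ℂ)) n).re * ((2 * π) ^ n * (n.factorial : ℝ)) =
        ∫ θ, (∏ i, ‖φ (θ i)‖) * ‖vandI n θ‖ ^ 2 ∂(torusMeasure n) := by
    intro φ h
    have := congrArg Complex.re h
    rwa [Complex.re_mul_ofReal, Complex.ofReal_re] at this
  have h1 := hre hf'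
  have h2 := hre hg'
  have hint : ∀ {φ : ℝ → ℂ}, Continuous φ →
      Integrable (fun θ : Fin n → ℝ => (∏ i, ‖φ (θ i)‖) * ‖vandI n θ‖ ^ 2) (torusMeasure n) := by
    intro φ hφ
    have hc : Continuous fun θ : Fin n → ℝ => (∏ i, ‖φ (θ i)‖) * ‖vandI n θ‖ ^ 2 :=
      (continuous_finsetProd _ fun i _ => (hφ.comp (continuous_apply i)).norm).mul
        ((continuous_vandI n).norm.pow 2)
    exact memLp_one_iff_integrable.1 (memLp_torus_of_continuous hc 1)
  have hmono : (∫ θ, (∏ i, ‖f (θ i)‖) * ‖vandI n θ‖ ^ 2 ∂(torusMeasure n)) ≤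
      ∫ θ, (∏ i, ‖g (θ i)‖) * ‖vandI n θ‖ ^ 2 ∂(torusMeasure n) := by
    refine integral_mono (hint hf) (hint hg) fun θ => ?_
    refine mul_le_mul_of_nonneg_right ?_ (sq_nonneg _)
    exact Finset.prod_le_prod (fun i _ => norm_nonneg _) fun i _ => hle _
  rw [← h1, ← h2] at hmono
  exact le_of_mul_le_mul_right hmono hK

/-- **Non-negativity**: `D_n(|f|) ≥ 0` for a continuous symbol. [folklore] -/
theorem toeplitzDet_norm_re_nonneg {f : ℝ → ℂ} (hf : Continuous f) (n : ℕ) :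
    0 ≤ (toeplitzDet (circleCoeff fun θ => (‖f θ‖ : ℂ)) n).re := by
  have hK := heineConst_pos n
  have h := toeplitzDet_norm_symbol_mul_eq hf n
  rw [← heineConst_cast] at h
  have h' := congrArg Complex.re h
  rw [Complex.re_mul_ofReal, Complex.ofReal_re] at h'
  have hI : 0 ≤ ∫ θ, (∏ i, ‖f (θ i)‖) * ‖vandI n θ‖ ^ 2 ∂(torusMeasure n) :=
    integral_nonneg fun θ => mul_nonneg (Finset.prod_nonneg fun i _ => norm_nonneg _) (sq_nonneg _)
  rw [← h'] at hI
  exact nonneg_of_mul_nonneg_left hI hK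

/-- **The Toeplitz determinant of a modulus symbol is real.** [folklore] -/
theorem toeplitzDet_norm_im {f : ℝ → ℂ} (hf : Continuous f) (n : ℕ) :
    (toeplitzDet (circleCoeff fun θ => (‖f θ‖ : ℂ)) n).im = 0 := by
  have hK := heineConst_pos n
  have h := toeplitzDet_norm_symbol_mul_eq hf n
  rw [← heineConst_cast] at h
  have h' := congrArg Complex.im h
  rw [Complex.im_mul_ofReal, Complex.ofReal_im] at h'
  exact (mul_eq_zero.1 h').resolve_right hK.ne'

/-- **Scaling**: `D_n(c f) = cⁿ D_n(f)`. [folklore] -/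
theorem toeplitzDet_const_mul (c : ℂ) (f : ℝ → ℂ) (n : ℕ) :
    toeplitzDet (circleCoeff fun θ => c * f θ) n = c ^ n * toeplitzDet (circleCoeff f) n := by
  have h : toeplitzMatrix (circleCoeff fun θ => c * f θ) n = c • toeplitzMatrix (circleCoeff f) n := by
    ext j k
    simp [toeplitzMatrix_apply, circleCoeff_const_mul]
  rw [toeplitzDet, toeplitzDet, h, det_smul, Fintype.card_fin]

/-- **Continuity of Toeplitz determinants in a parameter of the symbol.** [folklore] -/
theorem continuous_toeplitzDet_param {F : ℝ → ℝ → ℂ} (hF : Continuous (Function.uncurry F))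
    (n : ℕ) : Continuous fun t => toeplitzDet (circleCoeff (F t)) n := by
  have hcoeff : ∀ k : ℤ, Continuous fun t => circleCoeff (F t) k := by
    intro k
    unfold circleCoeff
    refine continuous_const.mul ?_
    refine intervalIntegral.continuous_parametric_intervalIntegral_of_continuous (a₀ := -π) ?_
      continuous_const
    exact ((by fun_prop : Continuous fun p : ℝ × ℝ => cexp (-(k * p.2 * I))).mul hF)
  unfold toeplitzDet
  refine Continuous.matrix_det ?_
  refine continuous_pi fun j => continuous_pi fun k => ?_
  simp only [toeplitzMatrix_apply]
  exact hcoeff _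

end ToeplitzTools

/-! ### Lenard's formula: the density matrix is a Toeplitz determinant -/

section LenardFormula

variable {n : ℕ} {L : ℝ}

/-- Lenard's weight in the position variable is Lenard's symbol in the angle `θ = 2πx/L`.
[cite: ClaeysKrasovsky2015, §1 (LdefR)] -/
theorem lenardSymbol_angle (L a b x : ℝ) :
    lenardSymbol (2 * π * a / L) (2 * π * b / L) (2 * π * x / L) =
      ((‖eL L x - eL L a‖ * ‖eL L x - eL L b‖ : ℝ) : ℂ) := by
  rw [lenardSymbol_eq_ofReal]; rfl

/-- The Fourier coefficients of Lenard's weight over `[0, L]` are the `circleCoeff`s of Lenard's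
symbol: `∫₀ᴸ |e(x)-e(a)||e(x)-e(b)| e^{2πimx/L} dx = L (f_{α,β})_{-m}`, `α = 2πa/L`, `β = 2πb/L`.
[folklore] -/
theorem setIntegral_weight_mul_ez (hL : 0 < L) (a b : ℝ) (m : ℤ) :
    ∫ x in Set.Icc 0 L, ((‖eL L x - eL L a‖ * ‖eL L x - eL L b‖ : ℝ) : ℂ) * ez L m x =
      (L : ℂ) * circleCoeff (lenardSymbol (2 * π * a / L) (2 * π * b / L)) (-m) := by
  set α : ℝ := 2 * π * a / L with hα
  set β : ℝ := 2 * π * b / L with hβ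
  set G : ℝ → ℂ := fun θ => lenardSymbol α β θ * cexp (m * θ * I) with hG
  have hGp : Function.Periodic G (2 * π) := by
    intro θ
    simp only [hG, lenardSymbol_periodic α β θ]
    congr 1
    rw [show (m : ℂ) * ((θ + 2 * π : ℝ) : ℂ) * I = m * θ * I + m * (2 * π * I) by push_cast; ring,
      Complex.exp_add, Complex.exp_int_mul_two_pi_mul_I, mul_one]
  have hc : (2 * π / L : ℝ) ≠ 0 := by positivity
  have hpt : ∀ x : ℝ, ((‖eL L x - eL L a‖ * ‖eL L x - eL L b‖ : ℝ) : ℂ) * ez L m x =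
      G (2 * π / L * x) := by
    intro x
    simp only [hG]
    rw [show 2 * π / L * x = 2 * π * x / L by ring, lenardSymbol_angle]
    congr 1
    unfold ez
    congr 1
    push_cast
    ring
  rw [integral_Icc_eq_integral_Ioc, ← intervalIntegral.integral_of_le hL.le,
    intervalIntegral.integral_congr fun x _ => hpt x,
    intervalIntegral.integral_comp_mul_left G hc, mul_zero,
    show 2 * π / L * L = 2 * π by field_simp]
  have hshift : ∫ θ in (0 : ℝ)..2 * π, G θ = ∫ θ in (-π)..π, G θ := by
    have h := hGp.intervalIntegral_add_eq 0 (-π)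
    rwa [zero_add, show -π + 2 * π = π by ring] at h
  have hI : ∫ θ in (-π)..π, G θ =
      ∫ θ in (-π)..π, cexp (-(((-m : ℤ) : ℂ) * θ * I)) * lenardSymbol α β θ := by
    refine intervalIntegral.integral_congr fun θ _ => ?_
    simp only [hG]
    rw [mul_comm]
    congr 2
    push_cast
    ring
  rw [hshift, hI, circleCoeff, Complex.real_smul]
  set J : ℂ := ∫ θ in (-π)..π, cexp (-(((-m : ℤ) : ℂ) * θ * I)) * lenardSymbol α β θ
  have hπ : (π : ℂ) ≠ 0 := by exact_mod_cast Real.pi_ne_zero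
  have hL' : (L : ℂ) ≠ 0 := by exact_mod_cast hL.ne'
  push_cast
  field_simp

/-- **Lenard's formula** (Lenard 1964; "also obtained independently by Dyson"): the one-body
density matrix of the Girardeau state of `n + 1` bosons is the `n × n` Toeplitz determinant of
Lenard's symbol with zeros at the two insertion points, `ρ_{n+1}(a, b) = L⁻¹ D_n(f_{2πa/L, 2πb/L})`
(Heine–Andréief identity applied to `ψ(X,a)ψ(X,b) = ((n+1)! L^{n+1})⁻¹ |Δ(X)|² ∏_j f(x_j)`).
[cite: ClaeysKrasovsky2015, §1 (Lrho), (LdefR), (Ldet)] [cite: DeiftItsKrasovsky2013, Remark 8 (34p3)] -/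
theorem density_eq_toeplitzDet (hL : 0 < L) (a b : ℝ) :
    (girardeauDensityMatrix (n + 1) L a b : ℂ) =
      (L : ℂ)⁻¹ * toeplitzDet (circleCoeff (lenardSymbol (2 * π * a / L) (2 * π * b / L))) n := by
  have hdef : girardeauDensityMatrix (n + 1) L a b = (n + 1 : ℝ) *
      ∫ X in Set.pi Set.univ (fun _ : Fin n => Set.Icc (0 : ℝ) L),
        girardeauState (n + 1) L (Fin.snoc X a) * girardeauState (n + 1) L (Fin.snoc X b) := rfl
  rw [hdef, Complex.ofReal_mul, ← integral_complex_ofReal]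
  set c : ℤ → ℂ := circleCoeff (lenardSymbol (2 * π * a / L) (2 * π * b / L)) with hc
  set w : ℝ → ℝ := fun x => ‖eL L x - eL L a‖ * ‖eL L x - eL L b‖ with hw
  set F : Fin n → ℝ → ℂ := fun t x => (w x : ℂ) * eL L x ^ (t : ℕ) with hF
  set G : Fin n → ℝ → ℂ := fun t x => conj (eL L x) ^ (t : ℕ) with hG
  set C2 : ℝ := ((n + 1).factorial : ℝ) * L ^ (n + 1) with hC2def
  have hC2pos : 0 < C2 := by positivity
  have hL0 : (L : ℂ) ≠ 0 := by exact_mod_cast hL.ne'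
  -- pointwise identity `ψ(X,a)ψ(X,b) = C2⁻¹ det[F] det[G]`
  have hpt : ∀ X : Fin n → ℝ,
      ((girardeauState (n + 1) L (Fin.snoc X a) * girardeauState (n + 1) L (Fin.snoc X b) : ℝ) :
        ℂ) = (C2 : ℂ)⁻¹ * (det (of fun r t => F t (X r)) * det (of fun r t => G t (X r))) := by
    intro X
    set A : ℂ := det (vandermonde fun j => eL L (X j)) with hA
    set Pa : ℂ := ∏ j, (eL L (X j) - eL L a) with hPa
    set Pb : ℂ := ∏ j, (eL L (X j) - eL L b) with hPb
    have hdetA : det (vandermonde fun j => eL L ((Fin.cons a X : Fin (n + 1) → ℝ) j)) = Pa * A := by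
      rw [eL_comp_cons, det_vandermonde_cons]
    have hdetB : det (vandermonde fun j => eL L ((Fin.cons b X : Fin (n + 1) → ℝ) j)) = Pb * A := by
      rw [eL_comp_cons, det_vandermonde_cons]
    have hgs : ∀ c' : ℝ, ∀ P : ℂ,
        det (vandermonde fun j => eL L ((Fin.cons c' X : Fin (n + 1) → ℝ) j)) = P * A →
        girardeauState (n + 1) L (Fin.snoc X c') = (Real.sqrt C2)⁻¹ * (‖P‖ * ‖A‖) := by
      intro c' P h
      rw [girardeauState_eq_norm_det, norm_det_vandermonde_snoc, h, norm_mul]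
    have hs : (Real.sqrt C2)⁻¹ * (Real.sqrt C2)⁻¹ = C2⁻¹ := by
      rw [← mul_inv, Real.mul_self_sqrt hC2pos.le]
    have hPnorm : ‖Pa‖ * ‖Pb‖ = ∏ j, w (X j) := by
      rw [hPa, hPb, norm_prod, norm_prod, ← Finset.prod_mul_distrib]
    have hFdet : det (of fun r t => F t (X r)) = (∏ j, (w (X j) : ℂ)) * A := by
      rw [hA]
      have : (of fun r t => F t (X r)) =
          of fun r t => (w (X r) : ℂ) * (vandermonde fun j => eL L (X j)) r t := by
        ext r t; simp [hF, vandermonde_apply]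
      rw [this, det_mul_column]
    have hGdet : det (of fun r t => G t (X r)) = conj A := by
      rw [hA, RingHom.map_det]
      congr 1
      ext r t
      simp [hG, vandermonde_apply, map_pow]
    rw [hgs a Pa hdetA, hgs b Pb hdetB, hFdet, hGdet]
    have hAA : A * conj A = ((‖A‖ ^ 2 : ℝ) : ℂ) := mul_conj_eq_norm_sq A
    calc (((Real.sqrt C2)⁻¹ * (‖Pa‖ * ‖A‖) * ((Real.sqrt C2)⁻¹ * (‖Pb‖ * ‖A‖)) : ℝ) : ℂ)
        = (((Real.sqrt C2)⁻¹ * (Real.sqrt C2)⁻¹ * (‖Pa‖ * ‖Pb‖) * ‖A‖ ^ 2 : ℝ) : ℂ) := by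
          congr 1; ring
      _ = ((C2⁻¹ * (∏ j, w (X j)) * ‖A‖ ^ 2 : ℝ) : ℂ) := by rw [hs, hPnorm]
      _ = (C2 : ℂ)⁻¹ * ((∏ j, (w (X j) : ℂ)) * (A * conj A)) := by
          rw [hAA]; push_cast; ring
      _ = (C2 : ℂ)⁻¹ * ((∏ j, (w (X j) : ℂ)) * A * conj A) := by ring
  have hS : MeasurableSet (Set.pi Set.univ fun _ : Fin n => Set.Icc (0 : ℝ) L) :=
    MeasurableSet.univ_pi fun _ => measurableSet_Icc
  rw [setIntegral_congr_fun hS (fun X _ => hpt X), integral_const_mul]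
  have hμ : (volume : Measure (Fin n → ℝ)).restrict (Set.pi Set.univ fun _ => Set.Icc (0 : ℝ) L) =
      Measure.pi fun _ : Fin n => (volume : Measure ℝ).restrict (Set.Icc 0 L) := by
    rw [volume_pi, Measure.restrict_pi_pi]
  have hwc : Continuous w := by
    simp only [hw]
    exact ((continuous_eL L).sub continuous_const).norm.mul
      ((continuous_eL L).sub continuous_const).norm
  have hFG : ∀ t t' : Fin n,
      Integrable (fun x => F t x * G t' x) ((volume : Measure ℝ).restrict (Set.Icc 0 L)) := by
    intro t t'
    have hcont : Continuous fun x => F t x * G t' x := by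
      simp only [hF, hG]
      exact ((Complex.continuous_ofReal.comp hwc).mul ((continuous_eL L).pow _)).mul
        ((Complex.continuous_conj.comp (continuous_eL L)).pow _)
    exact hcont.integrableOn_Icc
  rw [hμ, integral_det_mul_det _ F G hFG]
  -- the Gram matrix is `L` times the transposed Toeplitz matrix of Lenard's symbol
  have hentry : (of fun t t' => ∫ x, F t x * G t' x ∂((volume : Measure ℝ).restrict (Set.Icc 0 L))) =
      of fun t t' : Fin n => (L : ℂ) * c ((t' : ℤ) - (t : ℤ)) := by
    ext t t'
    simp only [of_apply]
    have hprod : ∀ x, F t x * G t' x = ((w x : ℝ) : ℂ) * ez L ((t : ℤ) - (t' : ℤ)) x := by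
      intro x
      simp only [hF, hG]
      rw [mul_assoc, eL_pow_mul_conj_pow]
    simp_rw [hprod]
    change ∫ x in Set.Icc 0 L, ((w x : ℝ) : ℂ) * ez L ((t : ℤ) - (t' : ℤ)) x = _
    rw [setIntegral_weight_mul_ez hL a b, neg_sub]
  rw [hentry]
  have hdet : det (of fun t t' : Fin n => (L : ℂ) * c ((t' : ℤ) - (t : ℤ))) =
      (L : ℂ) ^ n * toeplitzDet c n := by
    have : (of fun t t' : Fin n => (L : ℂ) * c ((t' : ℤ) - (t : ℤ))) =
        (L : ℂ) • (toeplitzMatrix c n)ᵀ := by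
      ext t t'
      simp [toeplitzMatrix_apply, transpose_apply]
    rw [this, det_smul, det_transpose, Fintype.card_fin, toeplitzDet]
  rw [hdet]
  have key : (((n : ℝ) + 1 : ℝ) : ℂ) * (C2 : ℂ)⁻¹ * (n.factorial : ℂ) * (L : ℂ) ^ n =
      (L : ℂ)⁻¹ := by
    have hnf : (n.factorial : ℂ) ≠ 0 := by exact_mod_cast Nat.factorial_ne_zero n
    have hn1 : ((n : ℂ) + 1) ≠ 0 := by exact_mod_cast Nat.succ_ne_zero n
    rw [hC2def, Nat.factorial_succ]
    push_cast
    field_simp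
    ring
  calc (((n : ℝ) + 1 : ℝ) : ℂ) * ((C2 : ℂ)⁻¹ * ((n.factorial : ℂ) * ((L : ℂ) ^ n * toeplitzDet c n)))
      = ((((n : ℝ) + 1 : ℝ) : ℂ) * (C2 : ℂ)⁻¹ * (n.factorial : ℂ) * (L : ℂ) ^ n) *
          toeplitzDet c n := by ring
    _ = (L : ℂ)⁻¹ * toeplitzDet c n := by rw [key]

/-- The Toeplitz determinant of Lenard's symbol only depends on the angular separation of its
zeros (rotation invariance of Toeplitz determinants). [folklore] -/
theorem toeplitzDet_lenardSymbol_eq_sub (α β : ℝ) (n : ℕ) :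
    toeplitzDet (circleCoeff (lenardSymbol α β)) n =
      toeplitzDet (circleCoeff (lenardSymbol (α - β) 0)) n := by
  have h : lenardSymbol α β = fun θ => lenardSymbol (α - β) 0 (θ - β) := by
    funext θ
    rw [show (0 : ℝ) = β - β by ring, lenardSymbol_sub]
  rw [h, toeplitzDet_comp_sub (lenardSymbol_periodic _ _)]

/-- **Lenard's determinant** `R(n, t) = D_n(f_{t,0})`, the `n × n` Toeplitz determinant of
Lenard's symbol with zeros at `1` and `e^{it}` (a non-negative real number; the printed `R_N(t)`
is `R(N-1, t)`). [cite: DeiftItsKrasovsky2013, Remark 8 (34p3)] -/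
def lenardDet (n : ℕ) (t : ℝ) : ℝ := (toeplitzDet (circleCoeff (lenardSymbol t 0)) n).re

/-- The Toeplitz determinant of Lenard's symbol is the real number `R(n, α - β)`. [folklore] -/
theorem toeplitzDet_lenardSymbol_eq_lenardDet (α β : ℝ) (n : ℕ) :
    toeplitzDet (circleCoeff (lenardSymbol α β)) n = (lenardDet n (α - β) : ℂ) := by
  rw [toeplitzDet_lenardSymbol_eq_sub]
  apply Complex.ext
  · simp [lenardDet]
  · rw [Complex.ofReal_im, lenardSymbol_eq_norm]
    exact toeplitzDet_norm_im ((continuous_lenardPoly_uncurry 0).comp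
      (Continuous.prodMk_right (α - β))) n

/-- `R(n, t) ≥ 0`. [folklore] -/
theorem lenardDet_nonneg (n : ℕ) (t : ℝ) : 0 ≤ lenardDet n t := by
  rw [lenardDet, lenardSymbol_eq_norm]
  exact toeplitzDet_norm_re_nonneg ((continuous_lenardPoly_uncurry 0).comp
    (Continuous.prodMk_right t)) n

/-- `R(0, t) = 1`. [folklore] -/
@[simp] theorem lenardDet_zero (t : ℝ) : lenardDet 0 t = 1 := by
  simp [lenardDet]

/-- `R(n, ·)` is `2π`-periodic. [folklore] -/
theorem lenardDet_periodic (n : ℕ) : Function.Periodic (lenardDet n) (2 * π) := by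
  intro t
  simp only [lenardDet]
  rw [show lenardSymbol (t + 2 * π) 0 = lenardSymbol t 0 from
    funext fun θ => lenardSymbol_add_two_pi_left t 0 θ]

/-- `R(n, ·)` is continuous. [folklore] -/
theorem continuous_lenardDet (n : ℕ) : Continuous (lenardDet n) :=
  Complex.continuous_re.comp
    (continuous_toeplitzDet_param (F := fun t θ => lenardSymbol t 0 θ)
      (continuous_lenardSymbol_uncurry 0) n)

/-- **Lenard's formula, real form**: `ρ_{n+1}(a, b) = L⁻¹ R(n, 2π(a-b)/L)`.
[cite: ClaeysKrasovsky2015, §1 (LdefR), (Ldet)] -/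
theorem girardeauDensityMatrix_eq_lenardDet (hL : 0 < L) (a b : ℝ) :
    girardeauDensityMatrix (n + 1) L a b = L⁻¹ * lenardDet n (2 * π * (a - b) / L) := by
  have h := density_eq_toeplitzDet (n := n) hL a b
  rw [toeplitzDet_lenardSymbol_eq_lenardDet,
    show 2 * π * a / L - 2 * π * b / L = 2 * π * (a - b) / L by ring] at h
  exact_mod_cast h

/-- **The zero-momentum occupation as a single integral of Lenard's determinant**:
`c₀(n+1) = (2π)⁻¹ ∫₀^{2π} R(n, t) dt` (independent of `L`).
[cite: ClaeysKrasovsky2015, §1 (Lrho0)] [cite: DeiftItsKrasovsky2013, Remark 8 (r34-1)] -/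
theorem zeroMomentumOccupation_succ_eq_integral (hL : 0 < L) (n : ℕ) :
    zeroMomentumOccupation (n + 1) L = (2 * π)⁻¹ * ∫ t in (0 : ℝ)..2 * π, lenardDet n t := by
  have hper : Function.Periodic (fun u => lenardDet n (2 * π * u / L)) L := by
    intro u
    simp only
    rw [show 2 * π * (u + L) / L = 2 * π * u / L + 2 * π by field_simp]
    exact lenardDet_periodic n _
  have hc : (2 * π / L : ℝ) ≠ 0 := by positivity
  have hscale : ∫ u in (0 : ℝ)..L, lenardDet n (2 * π * u / L) =
      L / (2 * π) * ∫ t in (0 : ℝ)..2 * π, lenardDet n t := by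
    have h := intervalIntegral.integral_comp_mul_left (a := 0) (b := L) (lenardDet n) hc
    rw [mul_zero, show 2 * π / L * L = 2 * π by field_simp, smul_eq_mul] at h
    rw [show (fun u => lenardDet n (2 * π * u / L)) = fun u => lenardDet n (2 * π / L * u) from
      funext fun u => by ring_nf, h]
    field_simp
  have hinner : ∀ x : ℝ, ∫ y in Set.Icc 0 L, girardeauDensityMatrix (n + 1) L x y =
      L⁻¹ * (L / (2 * π) * ∫ t in (0 : ℝ)..2 * π, lenardDet n t) := by
    intro x
    simp_rw [girardeauDensityMatrix_eq_lenardDet hL]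
    rw [integral_Icc_eq_integral_Ioc, ← intervalIntegral.integral_of_le hL.le,
      intervalIntegral.integral_const_mul]
    congr 1
    have h1 : ∫ y in (0 : ℝ)..L, lenardDet n (2 * π * (x - y) / L) =
        ∫ u in x - L..x - 0, lenardDet n (2 * π * u / L) :=
      intervalIntegral.integral_comp_sub_left (fun u => lenardDet n (2 * π * u / L)) x
    rw [h1, sub_zero]
    have h2 := hper.intervalIntegral_add_eq (x - L) 0
    rw [show x - L + L = x by ring, zero_add] at h2
    rw [h2, hscale]
  unfold zeroMomentumOccupation
  simp_rw [hinner]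
  rw [setIntegral_Icc_const hL.le]
  field_simp

end LenardFormula

/-! ### Fourier coefficients of the Poisson-regularised logarithmic kernel -/

section Coefficients

/-- The Fourier coefficients of `cos (m v)`: `(cos m·)_k = ([k = m] + [k = -m])/2`. [folklore] -/
theorem circleCoeff_cos_nat_mul (m : ℕ) (k : ℤ) :
    circleCoeff (fun v => ((Real.cos (m * v) : ℝ) : ℂ)) k =
      ((if k = (m : ℤ) then 1 else 0) + (if k = -(m : ℤ) then 1 else 0)) / 2 := by
  have h : (fun v : ℝ => ((Real.cos (m * v) : ℝ) : ℂ)) =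
      fun v : ℝ => (1 / 2 : ℂ) * cexp (((m : ℤ) : ℂ) * v * I) +
        (1 / 2 : ℂ) * cexp (((-(m : ℤ) : ℤ) : ℂ) * v * I) := by
    funext v
    rw [Complex.ofReal_cos, Complex.cos]
    push_cast
    ring_nf
  rw [h, circleCoeff_add (by fun_prop) (by fun_prop), circleCoeff_const_mul, circleCoeff_const_mul,
    circleCoeff_cexp_int_mul, circleCoeff_cexp_int_mul]
  ring

/-- **Fourier coefficients of the regularised logarithmic kernel** `ℓ_r(v) = log |1 - r e^{iv}|`
(`0 ≤ r < 1`): `(ℓ_r)_k = -r^{|k|}/(2|k|)` for `k ≠ 0` and `(ℓ_r)_0 = 0` (both cases of the displayed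
formula, with Lean's `1/0 = 0`); termwise from `ℓ_r = -∑_{m≥1} r^m cos(m v)/m`. [folklore] -/
theorem circleCoeff_circleLogKernelR {r : ℝ} (hr0 : 0 ≤ r) (hr1 : r < 1) (k : ℤ) :
    circleCoeff (fun v => (circleLogKernelR r v : ℂ)) k =
      -((r ^ k.natAbs / (2 * k.natAbs) : ℝ) : ℂ) := by
  set f : ℕ → ℝ → ℂ := fun m v => ((-(r ^ m / m) * Real.cos (m * v) : ℝ) : ℂ) with hf
  have hfc : ∀ m, Continuous (f m) := fun m => by simp only [hf]; fun_prop
  have hbound : ∀ m v, ‖f m v‖ ≤ r ^ m := by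
    intro m v
    simp only [hf, Complex.norm_real, Real.norm_eq_abs]
    rw [abs_mul, abs_neg, abs_div, abs_of_nonneg (pow_nonneg hr0 m)]
    rcases Nat.eq_zero_or_pos m with hm | hm
    · subst hm; simp
    · have hm' : (0 : ℝ) < m := by exact_mod_cast hm
      rw [abs_of_pos hm']
      calc r ^ m / m * |Real.cos (m * v)| ≤ r ^ m / m * 1 := by
            gcongr; exact Real.abs_cos_le_one _
        _ ≤ r ^ m := by
            rw [mul_one]; exact div_le_self (pow_nonneg hr0 m) (by exact_mod_cast hm)
  have hu : Summable fun m : ℕ => r ^ m := summable_geometric_of_lt_one hr0 hr1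
  have hunif : TendstoUniformly (fun N v => ∑ m ∈ Finset.range N, f m v)
      (fun v => ∑' m, f m v) atTop := tendstoUniformly_tsum_nat hu hbound
  have htsum : (fun v => ∑' m, f m v) = fun v => (circleLogKernelR r v : ℂ) := by
    funext v
    have h' : HasSum (fun m => f m v) (circleLogKernelR r v : ℂ) := by
      simp only [hf]
      exact Complex.hasSum_ofReal.2 (hasSum_circleLogKernelR hr0 hr1 v)
    exact h'.tsum_eq
  rw [htsum] at hunif
  -- coefficients of the partial sums
  have hcoefN : ∀ N, circleCoeff (fun v => ∑ m ∈ Finset.range N, f m v) k =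
      ∑ m ∈ Finset.range N, -((r ^ m / m : ℝ) : ℂ) *
        (((if k = (m : ℤ) then 1 else 0) + (if k = -(m : ℤ) then 1 else 0)) / 2) := by
    intro N
    rw [circleCoeff_finset_sum _ _ (fun m _ => hfc m)]
    refine Finset.sum_congr rfl fun m _ => ?_
    have : f m = fun v => (-((r ^ m / m : ℝ) : ℂ)) * ((Real.cos (m * v) : ℝ) : ℂ) := by
      funext v; simp only [hf]; push_cast; ring
    rw [this, circleCoeff_const_mul, circleCoeff_cos_nat_mul]
  have heventually : ∀ N, k.natAbs < N → circleCoeff (fun v => ∑ m ∈ Finset.range N, f m v) k =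
      -((r ^ k.natAbs / (2 * k.natAbs) : ℝ) : ℂ) := by
    intro N hN
    rw [hcoefN, Finset.sum_eq_single k.natAbs]
    · rcases lt_trichotomy k 0 with hk | hk | hk
      · have h1 : ¬ (k = (k.natAbs : ℤ)) := by omega
        have h2 : k = -(k.natAbs : ℤ) := by omega
        rw [if_neg h1, if_pos h2]
        push_cast; ring
      · subst hk; simp
      · have h1 : k = (k.natAbs : ℤ) := by omega
        have h2 : ¬ (k = -(k.natAbs : ℤ)) := by omega
        rw [if_pos h1, if_neg h2]
        push_cast; ring
    · intro m _ hm
      have h1 : ¬ (k = (m : ℤ)) := by omega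
      have h2 : ¬ (k = -(m : ℤ)) := by omega
      rw [if_neg h1, if_neg h2]
      ring
    · intro h
      exact absurd (Finset.mem_range.2 hN) h
  have hlim := tendsto_circleCoeff_of_tendstoUniformly
    (fun N => continuous_finsetSum _ fun m _ => hfc m)
    (Complex.continuous_ofReal.comp (continuous_circleLogKernelR hr0 hr1)) hunif k
  have hlim2 : Tendsto (fun N => circleCoeff (fun v => ∑ m ∈ Finset.range N, f m v) k) atTop
      (𝓝 (-((r ^ k.natAbs / (2 * k.natAbs) : ℝ) : ℂ))) := by
    apply tendsto_const_nhds.congr'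
    filter_upwards [eventually_gt_atTop k.natAbs] with N hN
    exact (heventually N hN).symm
  exact tendsto_nhds_unique hlim hlim2

/-- The norm of the displayed coefficient: `|(ℓ_r)_k| ≤ r^{|k|}` (`0 ≤ r`). [folklore] -/
theorem norm_coeff_le (r : ℝ) (hr0 : 0 ≤ r) (k : ℤ) :
    ‖-((r ^ k.natAbs / (2 * k.natAbs) : ℝ) : ℂ)‖ ≤ r ^ k.natAbs := by
  rw [norm_neg, Complex.norm_real, Real.norm_eq_abs, abs_div,
    abs_of_nonneg (pow_nonneg hr0 _)]
  rcases Nat.eq_zero_or_pos k.natAbs with hk | hk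
  · rw [hk]; simp
  · rw [abs_of_pos (by positivity)]
    exact div_le_self (pow_nonneg hr0 _) (by
      have : (1 : ℝ) ≤ k.natAbs := by exact_mod_cast hk
      linarith)

end Coefficients

/-! ### The Poisson-regularised symbol and its Szegő data -/

section Regularised

variable {r : ℝ}

/-- The logarithm of the regularised symbol:
`h_r(θ) = ℓ_r(θ - α) + ℓ_r(θ - β) - log r = log (|1 - r e^{i(θ-α)}| |1 - r e^{i(θ-β)}| / r)`.
[cite: Lenard1972, eqs. (13)–(14) (Szegő's regularisation `f_R`, here with `r = 1/R`)] -/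
def regLog (r α β θ : ℝ) : ℝ :=
  circleLogKernelR r (θ - α) + circleLogKernelR r (θ - β) - Real.log r

/-- The regularised symbol as a complex function whose modulus is `exp h_r`:
`G_r(θ) = (1 - r e^{i(θ-α)})(1 - r e^{i(θ-β)})/r`. [cite: Lenard1972, eq. (13)] -/
def regPoly (r α β θ : ℝ) : ℂ :=
  (1 - (r : ℂ) * cexp (↑(θ - α) * I)) * (1 - (r : ℂ) * cexp (↑(θ - β) * I)) / r

/-- `h_r` is continuous (`0 ≤ r < 1`). [folklore] -/
theorem continuous_regLog (hr0 : 0 ≤ r) (hr1 : r < 1) (α β : ℝ) :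
    Continuous (regLog r α β) := by
  unfold regLog
  exact (((continuous_circleLogKernelR hr0 hr1).comp (continuous_sub_right α)).add
    ((continuous_circleLogKernelR hr0 hr1).comp (continuous_sub_right β))).sub continuous_const

/-- `h_r` is `2π`-periodic. [folklore] -/
theorem regLog_periodic (r α β : ℝ) : Function.Periodic (regLog r α β) (2 * π) := by
  intro θ
  simp only [regLog]
  rw [show θ + 2 * π - α = θ - α + 2 * π by ring, show θ + 2 * π - β = θ - β + 2 * π by ring,
    periodic_circleLogKernelR r _, periodic_circleLogKernelR r _]

/-- `|G_r| = exp h_r` (`0 < r < 1`). [folklore] -/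
theorem norm_regPoly (hr0 : 0 < r) (hr1 : r < 1) (α β θ : ℝ) :
    ‖regPoly r α β θ‖ = Real.exp (regLog r α β θ) := by
  have hpos : ∀ v : ℝ, 0 < ‖1 - (r : ℂ) * cexp (v * I)‖ := fun v =>
    lt_of_lt_of_le (by linarith) (one_sub_le_norm_one_sub_mul_exp hr0.le v)
  rw [regPoly, regLog, norm_div, norm_mul, Complex.norm_real, Real.norm_of_nonneg hr0.le,
    Real.exp_sub, Real.exp_add, circleLogKernelR, circleLogKernelR, Real.exp_log (hpos _),
    Real.exp_log (hpos _), Real.exp_log hr0]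

/-- **Szegő's domination**: `|e^{iθ} - e^{iα}| |e^{iθ} - e^{iβ}| ≤ |G_r(θ)|` for `0 < r`, from
`|1 - r e^{iv}|² = (1-r)² + r |1 - e^{iv}|²`. [cite: Lenard1972, eqs. (13)–(15)] -/
theorem norm_lenardPoly_le_norm_regPoly (hr0 : 0 < r) (α β θ : ℝ) :
    ‖lenardPoly α β θ‖ ≤ ‖regPoly r α β θ‖ := by
  have key : ∀ v : ℝ, ‖cexp (θ * I) - cexp (v * I)‖ ≤
      ‖1 - (r : ℂ) * cexp (↑(θ - v) * I)‖ / Real.sqrt r := by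
    intro v
    have h1 : ‖cexp (θ * I) - cexp (v * I)‖ = ‖1 - cexp (↑(θ - v) * I)‖ := by
      have : cexp (θ * I) - cexp (v * I) = -(cexp (v * I) * (1 - cexp (↑(θ - v) * I))) := by
        rw [mul_sub, mul_one, ← Complex.exp_add]
        push_cast
        ring_nf
      rw [this, norm_neg, norm_mul, norm_exp_ofReal_mul_I, one_mul]
    rw [h1, le_div_iff₀ (Real.sqrt_pos.2 hr0)]
    have hsq := norm_one_sub_mul_exp_sq_eq r (θ - v)
    have h2 : r * ‖1 - cexp (↑(θ - v) * I)‖ ^ 2 ≤ ‖1 - (r : ℂ) * cexp (↑(θ - v) * I)‖ ^ 2 := by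
      rw [hsq]; nlinarith [sq_nonneg (1 - r)]
    have h3 : (‖1 - cexp (↑(θ - v) * I)‖ * Real.sqrt r) ^ 2 ≤
        ‖1 - (r : ℂ) * cexp (↑(θ - v) * I)‖ ^ 2 := by
      rw [mul_pow, Real.sq_sqrt hr0.le]; linarith
    exact (pow_le_pow_iff_left₀ (by positivity) (norm_nonneg _) two_ne_zero).1 h3
  rw [lenardPoly, norm_mul, regPoly, norm_div, norm_mul, Complex.norm_real,
    Real.norm_of_nonneg hr0.le]
  calc ‖cexp (θ * I) - cexp (α * I)‖ * ‖cexp (θ * I) - cexp (β * I)‖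
      ≤ (‖1 - (r : ℂ) * cexp (↑(θ - α) * I)‖ / Real.sqrt r) *
          (‖1 - (r : ℂ) * cexp (↑(θ - β) * I)‖ / Real.sqrt r) :=
        mul_le_mul (key α) (key β) (norm_nonneg _)
          (div_nonneg (norm_nonneg _) (Real.sqrt_nonneg _))
    _ = ‖1 - (r : ℂ) * cexp (↑(θ - α) * I)‖ * ‖1 - (r : ℂ) * cexp (↑(θ - β) * I)‖ / r := by
        rw [div_mul_div_comm, Real.mul_self_sqrt hr0.le]

/-- Lenard's polynomial is continuous in the angle. [folklore] -/
theorem continuous_lenardPoly (α β : ℝ) : Continuous (lenardPoly α β) := by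
  unfold lenardPoly; fun_prop

/-- The regularised polynomial is continuous in the angle. [folklore] -/
theorem continuous_regPoly (r α β : ℝ) : Continuous (regPoly r α β) := by
  unfold regPoly; fun_prop

/-- The Fourier coefficients of a constant. [folklore] -/
theorem circleCoeff_const_fun (c : ℂ) (k : ℤ) :
    circleCoeff (fun _ : ℝ => c) k = if k = 0 then c else 0 := by
  have h : (fun _ : ℝ => c) = fun v : ℝ => c * cexp (((0 : ℤ) : ℂ) * v * I) := by
    funext v; simp
  rw [h, circleCoeff_const_mul, circleCoeff_cexp_int_mul]
  split_ifs <;> simp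

/-- **The Fourier coefficients of `h_r`**:
`(h_r)_k = (e^{-ikα} + e^{-ikβ}) (ℓ_r)_k - (log r) [k = 0]`. [folklore] -/
theorem circleCoeff_regLog (hr0 : 0 < r) (hr1 : r < 1) (α β : ℝ) (k : ℤ) :
    circleCoeff (fun θ => (regLog r α β θ : ℂ)) k =
      (cexp (-(k * α * I)) + cexp (-(k * β * I))) * (-((r ^ k.natAbs / (2 * k.natAbs) : ℝ) : ℂ)) -
        (if k = 0 then (Real.log r : ℂ) else 0) := by
  have hper : Function.Periodic (fun v => (circleLogKernelR r v : ℂ)) (2 * π) := fun v => by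
    simp only [periodic_circleLogKernelR r v]
  have hc : Continuous fun v => (circleLogKernelR r v : ℂ) :=
    Complex.continuous_ofReal.comp (continuous_circleLogKernelR hr0.le hr1)
  have hfun : (fun θ => (regLog r α β θ : ℂ)) = fun θ =>
      ((fun v => (circleLogKernelR r v : ℂ)) (θ - α) + (fun v => (circleLogKernelR r v : ℂ)) (θ - β))
        - (fun _ : ℝ => (Real.log r : ℂ)) θ := by
    funext θ; simp only [regLog]; push_cast; ring
  have hcα : Continuous fun θ : ℝ => (fun v => (circleLogKernelR r v : ℂ)) (θ - α) :=
    hc.comp (continuous_sub_right α)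
  have hcβ : Continuous fun θ : ℝ => (fun v => (circleLogKernelR r v : ℂ)) (θ - β) :=
    hc.comp (continuous_sub_right β)
  rw [hfun, circleCoeff_sub (f := fun θ => (fun v => (circleLogKernelR r v : ℂ)) (θ - α) +
      (fun v => (circleLogKernelR r v : ℂ)) (θ - β)) (g := fun _ : ℝ => (Real.log r : ℂ))
      (hcα.add hcβ) continuous_const,
    circleCoeff_add (f := fun θ => (fun v => (circleLogKernelR r v : ℂ)) (θ - α))
      (g := fun θ => (fun v => (circleLogKernelR r v : ℂ)) (θ - β)) hcα hcβ,
    circleCoeff_comp_sub hper α, circleCoeff_comp_sub hper β,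
    circleCoeff_circleLogKernelR hr0.le hr1, circleCoeff_const_fun]
  ring

/-- The modulus of the displayed coefficient `-r^{|k|}/(2|k|)`. [folklore] -/
theorem norm_coeff_eq (hr0 : 0 ≤ r) (k : ℤ) :
    ‖-((r ^ k.natAbs / (2 * k.natAbs) : ℝ) : ℂ)‖ = r ^ k.natAbs / (2 * k.natAbs) := by
  rw [norm_neg, Complex.norm_real, Real.norm_of_nonneg (by positivity)]

/-- **Geometric decay of the coefficients of `h_r`**: `|(h_r)_k| ≤ (1 + |log r|) r^{|k|}`. [folklore] -/
theorem norm_circleCoeff_regLog_le (hr0 : 0 < r) (hr1 : r < 1) (α β : ℝ) (k : ℤ) :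
    ‖circleCoeff (fun θ => (regLog r α β θ : ℂ)) k‖ ≤ (1 + |Real.log r|) * r ^ k.natAbs := by
  rw [circleCoeff_regLog hr0 hr1]
  have he : ∀ x : ℝ, ‖cexp (-(k * x * I))‖ = 1 := fun x => by
    rw [show -((k : ℂ) * x * I) = ((-(k * x) : ℝ) : ℂ) * I by push_cast; ring]
    exact norm_exp_ofReal_mul_I _
  by_cases hk : k = 0
  · subst hk
    simp only [Int.natAbs_zero, pow_zero, Nat.cast_zero, mul_zero, div_zero, Complex.ofReal_zero,
      neg_zero, mul_zero, zero_sub, if_true, norm_neg, Complex.norm_real, Real.norm_eq_abs, mul_one]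
    linarith [abs_nonneg (Real.log r)]
  · rw [if_neg hk, sub_zero, norm_mul, norm_coeff_eq hr0.le]
    have hk1 : (1 : ℝ) ≤ k.natAbs := by
      have : 1 ≤ k.natAbs := Int.natAbs_pos.2 hk
      exact_mod_cast this
    calc ‖cexp (-(k * α * I)) + cexp (-(k * β * I))‖ * (r ^ k.natAbs / (2 * k.natAbs))
        ≤ (‖cexp (-(k * α * I))‖ + ‖cexp (-(k * β * I))‖) * (r ^ k.natAbs / (2 * k.natAbs)) := by
          gcongr; exact norm_add_le _ _
      _ = r ^ k.natAbs / k.natAbs := by rw [he, he]; ring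
      _ ≤ r ^ k.natAbs / 1 := by gcongr
      _ ≤ (1 + |Real.log r|) * r ^ k.natAbs := by
          rw [div_one]
          exact le_mul_of_one_le_left (pow_nonneg hr0.le _) (by linarith [abs_nonneg (Real.log r)])

/-- **The mean of `h_r`** is `-log r` (the regularised kernel has mean zero). [folklore] -/
theorem symbolMean_regLog (hr0 : 0 < r) (hr1 : r < 1) (α β : ℝ) :
    symbolMean (regLog r α β) = -Real.log r := by
  have h := circleCoeff_regLog hr0 hr1 α β 0
  rw [circleCoeff_ofReal_zero] at h
  simp only [Int.natAbs_zero, pow_zero, Nat.cast_zero, mul_zero, div_zero, Complex.ofReal_zero,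
    neg_zero, mul_zero, zero_sub, if_true] at h
  exact_mod_cast h

/-- `|2 cos x|² = 2 + 2 cos (2x)`, complex form. [folklore] -/
theorem norm_cexp_add_cexp_neg_sq (x : ℝ) :
    ‖cexp (-(x * I)) + cexp (-(-x * I))‖ ^ 2 = 2 + 2 * Real.cos (2 * x) := by
  have h : cexp (-(x * I)) + cexp (-(-x * I)) = ((2 * Real.cos x : ℝ) : ℂ) := by
    rw [Complex.ofReal_mul, Complex.ofReal_cos, Complex.ofReal_ofNat, Complex.two_cos]
    rw [show -(-(x : ℂ) * I) = x * I by ring, add_comm, neg_mul]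
  rw [h, Complex.norm_real, Real.norm_eq_abs, sq_abs, Real.cos_two_mul]
  ring

/-- **The Szegő sum of `h_r`** for symmetric zeros `±φ`:
`∑_{k≥1} k |(h_r)_k|² = ∑_{k≥1} r^{2k} cos²(kφ)/k = -½ log(1 - r²) - ½ ℓ_{r²}(2φ)`. [folklore] -/
theorem szegoSum_regLog_symm (hr0 : 0 < r) (hr1 : r < 1) (φ : ℝ) :
    szegoSum (regLog r φ (-φ)) =
      -(1 / 2) * Real.log (1 - r ^ 2) - (1 / 2) * circleLogKernelR (r ^ 2) (2 * φ) := by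
  have hρ1 : r ^ 2 < 1 := by nlinarith
  have hterm : ∀ k : ℕ,
      ((k : ℝ) + 1) * ‖circleCoeff (fun θ => (regLog r φ (-φ) θ : ℂ)) ((k : ℤ) + 1)‖ ^ 2 =
        (1 / 2) * ((r ^ 2) ^ (k + 1) / (k + 1)) +
          (-(1 / 2)) * (-((r ^ 2) ^ (k + 1) / ((k + 1 : ℕ) : ℝ)) *
            Real.cos (((k + 1 : ℕ) : ℝ) * (2 * φ))) := by
    intro k
    have hk0 : ((k : ℤ) + 1) ≠ 0 := by omega
    rw [circleCoeff_regLog hr0 hr1, if_neg hk0, sub_zero, norm_mul, norm_coeff_eq hr0.le]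
    have hna : ((k : ℤ) + 1).natAbs = k + 1 := by omega
    rw [hna]
    have hphase : ‖cexp (-(((k : ℤ) + 1 : ℤ) * φ * I)) + cexp (-(((k : ℤ) + 1 : ℤ) * (-φ : ℝ) * I))‖ ^ 2 =
        2 + 2 * Real.cos (((k + 1 : ℕ) : ℝ) * (2 * φ)) := by
      have h := norm_cexp_add_cexp_neg_sq (((k + 1 : ℕ) : ℝ) * φ)
      have e1 : (((k : ℤ) + 1 : ℤ) : ℂ) * φ * I = ((((k + 1 : ℕ) : ℝ) * φ : ℝ) : ℂ) * I := by
        push_cast; ring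
      have e2 : (((k : ℤ) + 1 : ℤ) : ℂ) * ((-φ : ℝ) : ℂ) * I =
          -((((k + 1 : ℕ) : ℝ) * φ : ℝ) : ℂ) * I := by
        push_cast; ring
      rw [e1, e2, h]
      congr 2
      ring
    rw [mul_pow, hphase]
    push_cast
    have hk1 : ((k : ℝ) + 1) ≠ 0 := by positivity
    field_simp
    ring
  unfold szegoSum
  rw [tsum_congr hterm]
  have h1 : HasSum (fun k : ℕ => (r ^ 2) ^ (k + 1) / ((k : ℝ) + 1)) (-Real.log (1 - r ^ 2)) := by
    have := Real.hasSum_pow_div_log_of_abs_lt_one (x := r ^ 2)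
      (by rw [abs_of_nonneg (sq_nonneg r)]; exact hρ1)
    simpa using this
  have h2 : HasSum (fun k : ℕ => -((r ^ 2) ^ (k + 1) / ((k + 1 : ℕ) : ℝ)) *
      Real.cos (((k + 1 : ℕ) : ℝ) * (2 * φ))) (circleLogKernelR (r ^ 2) (2 * φ)) := by
    have h := hasSum_circleLogKernelR (sq_nonneg r) hρ1 (2 * φ)
    rw [← hasSum_nat_add_iff' 1] at h
    simpa using h
  rw [((h1.mul_left (1 / 2)).add (h2.mul_left (-(1 / 2)))).tsum_eq]
  ring

end Regularised

/-! ### The Szegő–Lenard bound `R(n, t) ≤ 2e √(n+1) / √|sin(t/2)|` -/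

section SzegoBound

variable {r : ℝ}

/-- **Szegő's inequality, raw form** (Szegő 1963 / Lenard 1964 / Lenard 1972, Theorem (29)): for
`0 < r < 1`, `R(n, t) ≤ exp(S(h_r) - n log r)`, i.e. `D_n(f_t) ≤ r^{-n} e^{∑ k|(h_r)_k|²}`, by
domination of the symbol, monotonicity of `D_n`, and the strong Szegő inequality
`D_n(e^h) ≤ e^{n h_0} e^{∑ k |h_k|²}`. [cite: Lenard1972, eqs. (15)–(16) and (24)] -/
theorem lenardDet_le_exp (hr0 : 0 < r) (hr1 : r < 1) (n : ℕ) (t : ℝ) :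
    lenardDet n t ≤ Real.exp (szegoSum (regLog r (t / 2) (-(t / 2))) - n * Real.log r) := by
  have hrot : lenardDet n t =
      (toeplitzDet (circleCoeff (lenardSymbol (t / 2) (-(t / 2)))) n).re := by
    rw [lenardDet, toeplitzDet_lenardSymbol_eq_sub (t / 2) (-(t / 2)),
      show t / 2 - -(t / 2) = t by ring]
  set h : ℝ → ℝ := regLog r (t / 2) (-(t / 2)) with hh
  have hc : Continuous h := continuous_regLog hr0.le hr1 _ _
  have hp : Function.Periodic h (2 * π) := regLog_periodic r _ _
  set D : ℝ := (toeplitzDet (circleCoeff fun θ => (Real.exp (h θ) : ℂ)) n).re with hD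
  have hmono : (toeplitzDet (circleCoeff (lenardSymbol (t / 2) (-(t / 2)))) n).re ≤ D := by
    have hexp : (fun θ => (Real.exp (h θ) : ℂ)) =
        fun θ => ((‖regPoly r (t / 2) (-(t / 2)) θ‖ : ℝ) : ℂ) := by
      funext θ; rw [norm_regPoly hr0 hr1]
    rw [hD, hexp, lenardSymbol_eq_norm]
    exact toeplitzDet_norm_re_mono (continuous_lenardPoly _ _) (continuous_regPoly r _ _)
      (fun θ => norm_lenardPoly_le_norm_regPoly hr0 _ _ θ) n
  have hgeo := norm_circleCoeff_regLog_le hr0 hr1 (t / 2) (-(t / 2))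
  have hSz := logSzego_le_szegoSum_of_geometric hc hp hr0.le hr1 hgeo n
  have hDpos : 0 < D := toeplitzDet_exp_re_pos hc n
  rw [logSzego, symbolMean_regLog hr0 hr1] at hSz
  have hlog : Real.log D ≤ szegoSum h - n * Real.log r := by
    have : Real.log D - n * -Real.log r ≤ szegoSum h := hSz
    linarith
  calc lenardDet n t = _ := hrot
    _ ≤ D := hmono
    _ ≤ Real.exp (szegoSum h - n * Real.log r) := (Real.log_le_iff_le_exp hDpos).1 hlog

/-- `|1 - e^{it}| = 2 |sin(t/2)|`. [folklore] -/
theorem norm_one_sub_cexp (t : ℝ) : ‖1 - cexp (t * I)‖ = 2 * |Real.sin (t / 2)| := by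
  have h := norm_exp_I_sub_exp_I 0 t
  simp only [Complex.ofReal_zero, zero_mul, Complex.exp_zero, zero_sub] at h
  rw [h, show -t / 2 = -(t / 2) by ring, Real.sin_neg, abs_neg]

/-- **The Szegő–Lenard bound**: `R(n, t) ≤ 2e √(n+1) / √|sin(t/2)|` for every `n` and every
`t` off `2πℤ` (Szegő's letter of 10 July 1963: `|R_N(t)| ≤ |eN/sin(t/2)|^{1/2}`; here with the
regularisation parameter `r = (n+1)/(n+2)` and a slightly larger constant).
[cite: DeiftItsKrasovsky2013, Remark 8 (r34-2)] [cite: Lenard1972, Theorem, eq. (29)] -/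
theorem lenardDet_le_sqrt (n : ℕ) {t : ℝ} (ht : Real.sin (t / 2) ≠ 0) :
    lenardDet n t ≤ 2 * Real.exp 1 * Real.sqrt (n + 1) / Real.sqrt |Real.sin (t / 2)| := by
  set N : ℝ := (n : ℝ) + 1 with hN
  have hN1 : 1 ≤ N := by rw [hN]; linarith [(Nat.cast_nonneg n : (0 : ℝ) ≤ n)]
  have hN0 : 0 < N := by linarith
  set r : ℝ := N / (N + 1) with hr
  have hr0 : 0 < r := by positivity
  have hr1 : r < 1 := by rw [hr, div_lt_one (by positivity)]; linarith
  have hρ1 : r ^ 2 < 1 := by nlinarith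
  set s : ℝ := |Real.sin (t / 2)| with hs
  have hs0 : 0 < s := abs_pos.2 ht
  -- the raw bound and its explicit value
  have hB := lenardDet_le_exp hr0 hr1 n t
  rw [szegoSum_regLog_symm hr0 hr1, show 2 * (t / 2) = t by ring] at hB
  set M : ℝ := ‖1 - ((r ^ 2 : ℝ) : ℂ) * cexp (t * I)‖ with hM
  have hM_ge : r * (2 * s) ≤ M := by
    have hsq := norm_one_sub_mul_exp_sq_eq (r ^ 2) t
    rw [norm_one_sub_cexp] at hsq
    have h1 : (r * (2 * s)) ^ 2 ≤ M ^ 2 := by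
      rw [hM, hsq]; nlinarith [sq_nonneg (1 - r ^ 2), sq_nonneg s]
    exact (pow_le_pow_iff_left₀ (by positivity) (norm_nonneg _) two_ne_zero).1 h1
  have hMpos : 0 < M := lt_of_lt_of_le (by positivity) hM_ge
  have h1r : 0 < 1 - r ^ 2 := by linarith
  set B : ℝ := Real.exp (-(1 / 2) * Real.log (1 - r ^ 2) - 1 / 2 * circleLogKernelR (r ^ 2) t -
    n * Real.log r) with hBdef
  have hB0 : 0 ≤ B := (Real.exp_pos _).le
  -- `B² = (1 - r²)⁻¹ M⁻¹ r⁻²ⁿ`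
  have hB2 : B ^ 2 = (1 - r ^ 2)⁻¹ * M⁻¹ * r⁻¹ ^ (2 * n) := by
    have hlogM : circleLogKernelR (r ^ 2) t = Real.log M := by rw [circleLogKernelR, hM]
    have h2 : 2 * (-(1 / 2) * Real.log (1 - r ^ 2) - 1 / 2 * circleLogKernelR (r ^ 2) t -
        n * Real.log r) = Real.log ((1 - r ^ 2)⁻¹ * M⁻¹ * r⁻¹ ^ (2 * n)) := by
      rw [Real.log_mul (mul_ne_zero (inv_ne_zero h1r.ne') (inv_ne_zero hMpos.ne'))
          (pow_ne_zero _ (inv_ne_zero hr0.ne')),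
        Real.log_mul (inv_ne_zero h1r.ne') (inv_ne_zero hMpos.ne'), Real.log_inv, Real.log_inv,
        Real.log_pow, Real.log_inv, hlogM]
      push_cast
      ring
    rw [hBdef, sq, ← Real.exp_add, ← two_mul, h2, Real.exp_log (by positivity)]
  -- the three factors
  have hf1 : (1 - r ^ 2)⁻¹ = (N + 1) ^ 2 / (2 * N + 1) := by
    have : 1 - r ^ 2 = (2 * N + 1) / (N + 1) ^ 2 := by
      rw [hr]; field_simp; ring
    rw [this, inv_div]
  have hf2 : M⁻¹ ≤ (N + 1) / (N * (2 * s)) := by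
    have : (r * (2 * s))⁻¹ = (N + 1) / (N * (2 * s)) := by
      rw [hr]; field_simp
    rw [← this]
    exact (inv_le_inv₀ hMpos (by positivity)).2 hM_ge
  have hf3 : r⁻¹ ^ (2 * n) ≤ Real.exp 1 ^ 2 := by
    have hrinv : r⁻¹ = 1 / N + 1 := by rw [hr]; field_simp; ring
    have hle : r⁻¹ ≤ Real.exp (1 / N) := by rw [hrinv]; exact Real.add_one_le_exp _
    calc r⁻¹ ^ (2 * n) ≤ Real.exp (1 / N) ^ (2 * n) :=
          pow_le_pow_left₀ (inv_pos.2 hr0).le hle _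
      _ = Real.exp ((2 * n : ℕ) * (1 / N)) := (Real.exp_nat_mul _ _).symm
      _ ≤ Real.exp 2 := by
          refine Real.exp_le_exp.2 ?_
          rw [hN]
          push_cast
          rw [mul_one_div, div_le_iff₀ (by positivity)]
          linarith
      _ = Real.exp 1 ^ 2 := by rw [← Real.exp_nat_mul]; norm_num
  have hpoly : (N + 1) ^ 3 ≤ 8 * N ^ 2 * (2 * N + 1) := by
    nlinarith [sq_nonneg N, mul_nonneg (by linarith : (0 : ℝ) ≤ N - 1) (sq_nonneg N),
      mul_nonneg (by linarith : (0 : ℝ) ≤ N - 1) hN0.le]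
  have hB2le : B ^ 2 ≤ (2 * Real.exp 1) ^ 2 * N / s := by
    rw [hB2]
    calc (1 - r ^ 2)⁻¹ * M⁻¹ * r⁻¹ ^ (2 * n)
        ≤ (N + 1) ^ 2 / (2 * N + 1) * ((N + 1) / (N * (2 * s))) * Real.exp 1 ^ 2 := by
          rw [hf1]; gcongr
      _ = Real.exp 1 ^ 2 / s * ((N + 1) ^ 3 / ((2 * N + 1) * (2 * N))) := by
          field_simp
      _ ≤ Real.exp 1 ^ 2 / s * (4 * N) := by
          gcongr
          rw [div_le_iff₀ (by positivity)]
          nlinarith [hpoly]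
      _ = (2 * Real.exp 1) ^ 2 * N / s := by ring
  have hBle : B ≤ 2 * Real.exp 1 * Real.sqrt N / Real.sqrt s := by
    have h := (Real.le_sqrt hB0 (by positivity)).2 hB2le
    rwa [Real.sqrt_div (by positivity), Real.sqrt_mul (by positivity), Real.sqrt_sq (by positivity)]
      at h
  exact hB.trans hBle

end SzegoBound

/-! ### Integration: `c₀(N) ≤ 4e √N` for every `N` -/

section SqrtBound

/-- Jordan's inequality in the form `t/π ≤ sin(t/2)` on `[0, π]`. [folklore] -/
theorem div_pi_le_sin_half {t : ℝ} (ht0 : 0 ≤ t) (htπ : t ≤ π) : t / π ≤ Real.sin (t / 2) := by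
  have h := Real.mul_le_sin (x := t / 2) (by linarith) (by linarith)
  calc t / π = 2 / π * (t / 2) := by ring
    _ ≤ Real.sin (t / 2) := h

/-- The Szegő–Lenard bound with the algebraic majorant `√π u^{-1/2}`, `u ∈ (0, π]` the angular
distance to `2πℤ`. [folklore] -/
theorem lenardDet_le_of_sin (n : ℕ) {t u : ℝ} (hsin : Real.sin (t / 2) = Real.sin (u / 2))
    (hu0 : 0 < u) (huπ : u ≤ π) :
    lenardDet n t ≤
      2 * Real.exp 1 * Real.sqrt (n + 1) * (Real.sqrt π * u ^ (-(1 / 2 : ℝ))) := by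
  have hsin_ge := div_pi_le_sin_half hu0.le huπ
  have hup : 0 < u / π := by positivity
  have hpos : 0 < Real.sin (u / 2) := lt_of_lt_of_le hup hsin_ge
  have hb := lenardDet_le_sqrt n (t := t) (by rw [hsin]; exact hpos.ne')
  rw [hsin, abs_of_pos hpos] at hb
  refine hb.trans ?_
  rw [div_eq_mul_inv (2 * Real.exp 1 * Real.sqrt (n + 1))]
  gcongr
  calc (Real.sqrt (Real.sin (u / 2)))⁻¹ ≤ (Real.sqrt (u / π))⁻¹ :=
        inv_anti₀ (Real.sqrt_pos.2 hup) (Real.sqrt_le_sqrt hsin_ge)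
    _ = Real.sqrt π * u ^ (-(1 / 2 : ℝ)) := by
        rw [Real.sqrt_div' _ Real.pi_pos.le, inv_div, Real.rpow_neg hu0.le, ← Real.sqrt_eq_rpow,
          div_eq_mul_inv]

/-- `∫₀^π t^{-1/2} dt = 2√π`. [folklore] -/
theorem integral_rpow_neg_half_pi : ∫ t in (0 : ℝ)..π, t ^ (-(1 / 2 : ℝ)) = 2 * Real.sqrt π := by
  rw [integral_rpow (Or.inl (by norm_num)), show (-(1 / 2 : ℝ) + 1) = 1 / 2 by norm_num,
    Real.zero_rpow (by norm_num), sub_zero, ← Real.sqrt_eq_rpow]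
  ring

/-- **The integrated Szegő–Lenard bound**: `∫₀^{2π} R(n, t) dt ≤ 8πe √(n+1)`.
[cite: DeiftItsKrasovsky2013, Remark 8 (r34-1)–(r34-2)] -/
theorem integral_lenardDet_le (n : ℕ) :
    ∫ t in (0 : ℝ)..2 * π, lenardDet n t ≤ 8 * π * Real.exp 1 * Real.sqrt (n + 1) := by
  set K : ℝ := 2 * Real.exp 1 * Real.sqrt (n + 1) with hK
  have hint : ∀ a b : ℝ, IntervalIntegrable (lenardDet n) volume a b := fun a b =>
    (continuous_lenardDet n).intervalIntegrable a b
  have hπ := Real.pi_pos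
  have hL : ∫ t in (0 : ℝ)..π, lenardDet n t ≤
      ∫ t in (0 : ℝ)..π, K * (Real.sqrt π * t ^ (-(1 / 2 : ℝ))) := by
    refine intervalIntegral.integral_mono_on_of_le_Ioo hπ.le (hint 0 π) ?_ fun t ht => ?_
    · exact ((intervalIntegral.intervalIntegrable_rpow' (by norm_num)).const_mul _).const_mul _
    · exact lenardDet_le_of_sin n rfl ht.1 ht.2.le
  have hR : ∫ t in π..2 * π, lenardDet n t ≤
      ∫ t in π..2 * π, K * (Real.sqrt π * (2 * π - t) ^ (-(1 / 2 : ℝ))) := by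
    refine intervalIntegral.integral_mono_on_of_le_Ioo (by linarith) (hint _ _) ?_ fun t ht => ?_
    · have h := (intervalIntegral.intervalIntegrable_rpow' (a := π) (b := 0)
        (by norm_num : (-1 : ℝ) < -(1 / 2))).comp_sub_left (2 * π)
      rw [show 2 * π - π = π by ring, sub_zero] at h
      exact (h.const_mul _).const_mul _
    · exact lenardDet_le_of_sin n
        (by rw [show (2 * π - t) / 2 = π - t / 2 by ring, Real.sin_pi_sub])
        (by linarith [ht.2]) (by linarith [ht.1])
  have hsq : Real.sqrt π * (2 * Real.sqrt π) = 2 * π := by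
    rw [show Real.sqrt π * (2 * Real.sqrt π) = 2 * (Real.sqrt π * Real.sqrt π) by ring,
      Real.mul_self_sqrt hπ.le]
  have hIL : ∫ t in (0 : ℝ)..π, K * (Real.sqrt π * t ^ (-(1 / 2 : ℝ))) = K * (2 * π) := by
    rw [intervalIntegral.integral_const_mul, intervalIntegral.integral_const_mul,
      integral_rpow_neg_half_pi, hsq]
  have hIR : ∫ t in π..2 * π, K * (Real.sqrt π * (2 * π - t) ^ (-(1 / 2 : ℝ))) = K * (2 * π) := by
    rw [intervalIntegral.integral_const_mul, intervalIntegral.integral_const_mul]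
    have h := intervalIntegral.integral_comp_sub_left (a := π) (b := 2 * π)
      (fun u : ℝ => u ^ (-(1 / 2 : ℝ))) (2 * π)
    rw [show 2 * π - 2 * π = (0 : ℝ) by ring, show 2 * π - π = π by ring] at h
    rw [h, integral_rpow_neg_half_pi, hsq]
  rw [← intervalIntegral.integral_add_adjacent_intervals (hint 0 π) (hint π (2 * π))]
  calc (∫ t in (0 : ℝ)..π, lenardDet n t) + ∫ t in π..2 * π, lenardDet n t
      ≤ K * (2 * π) + K * (2 * π) := add_le_add (hL.trans_eq hIL) (hR.trans_eq hIR)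
    _ = 8 * π * Real.exp 1 * Real.sqrt (n + 1) := by rw [hK]; ring

/-- **The `√N` law, upper bound** (Szegő–Lenard): `c₀(N) ≤ 4e √N < 11 √N` for EVERY `N` and
every circumference `L > 0` ("`λ_max/N = (2πN)⁻¹ ∫ R_N = O(N^{-1/2})`").
[cite: DeiftItsKrasovsky2013, Remark 8 (r34-1)–(r34-2)] [cite: ClaeysKrasovsky2015, §1 after (Lrho0)] -/
theorem zeroMomentumOccupation_le_sqrt (N : ℕ) {L : ℝ} (hL : 0 < L) :
    zeroMomentumOccupation N L ≤ 4 * Real.exp 1 * Real.sqrt N := by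
  cases N with
  | zero => simp
  | succ n =>
    rw [zeroMomentumOccupation_succ_eq_integral hL n]
    have h := integral_lenardDet_le n
    have hπ := Real.pi_pos
    calc (2 * π)⁻¹ * ∫ t in (0 : ℝ)..2 * π, lenardDet n t
        ≤ (2 * π)⁻¹ * (8 * π * Real.exp 1 * Real.sqrt (n + 1)) := by gcongr
      _ = 4 * Real.exp 1 * Real.sqrt ((n + 1 : ℕ) : ℝ) := by
          push_cast
          field_simp
          ring

end SqrtBound

end Literature.Barriers.AtomisticToContinuum.BoseGas

namespace Literature.Barriers.AtomisticToContinuum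

open BoseGas

/-- **Szegő–Lenard (1963/64): the zero-momentum occupation of the impenetrable one-dimensional
Bose gas is `O(√N)`, uniformly in `N` and `L`** — the ORDER half of the printed sharp law
`OneDimensionalHardCoreSqrt` (`c₀(N) ∼ 1.5427 √N`), proved: `c₀(N) ≤ 4e √N` for all `N`.
(Lenard's Toeplitz formula `Lρ_N = D_{N-1}(f_t)`, Szegő's inequality `R_N(t) ≲ √(N/ sin(t/2))`
via the strong Szegő inequality of `Literature.Analysis.Toeplitz`, and `∫ sin^{-1/2} < ∞`.)
[cite: DeiftItsKrasovsky2013, Remark 8 (r34-1)–(r34-2)] [cite: Lenard1972, Theorem, eq. (29)]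
[cite: ClaeysKrasovsky2015, §1 (Lrho0)] -/
theorem oneDimensionalHardCore_sqrt_upper (L : ℝ) (hL : 0 < L) (N : ℕ) :
    zeroMomentumOccupation N L ≤ 4 * Real.exp 1 * Real.sqrt N :=
  zeroMomentumOccupation_le_sqrt N hL

end Literature.Barriers.AtomisticToContinuum


/-! ## Dyson's constant modulo the pointwise Fisher–Hartwig asymptotics -/

namespace Literature.Barriers.AtomisticToContinuum.BoseGas

open Literature.Analysis.Toeplitz

section DysonConstant

/-- The pointwise Fisher–Hartwig profile `E |e^{it} - 1|^{-1/2}` (`= E (2|sin(t/2)|)^{-1/2}`), the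
limit of `R(n, t)/√n`. [cite: DeiftItsKrasovsky2013, §6 (eq84)–(eq85)] -/
def fhProfile (E t : ℝ) : ℝ := E * ‖cexp (t * I) - 1‖ ^ (-(1 / 2 : ℝ))

/-- `e^{it} ≠ 1` for `t ∈ (0, 2π)`. [folklore] -/
theorem cexp_ne_one_of_mem_Ioo {t : ℝ} (ht : t ∈ Set.Ioo 0 (2 * π)) : cexp (t * I) ≠ 1 := by
  rw [Ne, exp_mul_I_eq_one_iff]
  rintro ⟨m, hm⟩
  have hπ := Real.pi_pos
  have h1 : (0 : ℝ) < m := by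
    have h := ht.1; rw [hm] at h
    by_contra hle; push Not at hle
    nlinarith
  have h2 : (m : ℝ) < 1 := by
    have h := ht.2; rw [hm] at h
    by_contra hge; push Not at hge
    nlinarith
  have h1' : (0 : ℤ) < m := by exact_mod_cast h1
  have h2' : m < (1 : ℤ) := by exact_mod_cast h2
  omega

/-- **Pointwise limit under the Fisher–Hartwig fact**: `R(n, t)/√n → E |e^{it} - 1|^{-1/2}` off
`2πℤ`. [cite: DeiftItsKrasovsky2013, §6 (eq84)–(eq85)] -/
theorem tendsto_lenardDet_div_sqrt {E t : ℝ}
    (h : Tendsto (fun n : ℕ => toeplitzDet (circleCoeff (lenardSymbol t 0)) n /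
        ((Real.sqrt n : ℝ) : ℂ)) atTop
      (𝓝 (((E * ‖cexp (t * I) - cexp ((0 : ℝ) * I)‖ ^ (-(1 / 2 : ℝ)) : ℝ) : ℂ)))) :
    Tendsto (fun n : ℕ => lenardDet n t / Real.sqrt n) atTop (𝓝 (fhProfile E t)) := by
  have hfun : (fun n : ℕ => toeplitzDet (circleCoeff (lenardSymbol t 0)) n /
        ((Real.sqrt n : ℝ) : ℂ)) = fun n : ℕ => ((lenardDet n t / Real.sqrt n : ℝ) : ℂ) := by
    funext n
    rw [toeplitzDet_lenardSymbol_eq_lenardDet, sub_zero, Complex.ofReal_div]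
  have hval : (((E * ‖cexp (t * I) - cexp ((0 : ℝ) * I)‖ ^ (-(1 / 2 : ℝ)) : ℝ) : ℂ)) =
      ((fhProfile E t : ℝ) : ℂ) := by
    simp [fhProfile]
  rw [hfun, hval] at h
  have h' : Tendsto (fun n : ℕ => ((lenardDet n t / Real.sqrt n : ℝ) : ℂ).re) atTop
      (𝓝 ((fhProfile E t : ℝ) : ℂ).re) := (Complex.continuous_re.tendsto _).comp h
  simpa only [Complex.ofReal_re] using h'

/-- The algebraic majorant `2e√π (t^{-1/2} + (2π - t)^{-1/2})` of `R(n,t)/√(n+1)` on `(0, 2π)`.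
[folklore] -/
def sqrtBound (t : ℝ) : ℝ :=
  2 * Real.exp 1 * Real.sqrt π * (t ^ (-(1 / 2 : ℝ)) + (2 * π - t) ^ (-(1 / 2 : ℝ)))

/-- The majorant is integrable on `[0, 2π]`. [folklore] -/
theorem intervalIntegrable_sqrtBound : IntervalIntegrable sqrtBound volume 0 (2 * π) := by
  have h1 : IntervalIntegrable (fun t : ℝ => t ^ (-(1 / 2 : ℝ))) volume 0 (2 * π) :=
    intervalIntegral.intervalIntegrable_rpow' (by norm_num)
  have h2 : IntervalIntegrable (fun t : ℝ => (2 * π - t) ^ (-(1 / 2 : ℝ))) volume 0 (2 * π) := by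
    have h := (intervalIntegral.intervalIntegrable_rpow' (a := 2 * π) (b := 0)
      (by norm_num : (-1 : ℝ) < -(1 / 2))).comp_sub_left (2 * π)
    rw [sub_self, sub_zero] at h
    exact h
  exact (h1.add h2).const_mul _

/-- **Domination**: `0 ≤ R(n, t)/√(n+1) ≤ 2e√π (t^{-1/2} + (2π - t)^{-1/2})` on `(0, 2π)`.
[cite: Lenard1972, Theorem, eq. (29)] -/
theorem lenardDet_div_sqrt_le_sqrtBound (n : ℕ) {t : ℝ} (ht : t ∈ Set.Ioo 0 (2 * π)) :
    lenardDet n t / Real.sqrt (n + 1) ≤ sqrtBound t := by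
  have hK : 0 < Real.sqrt (n + 1) := Real.sqrt_pos.2 (by positivity)
  have hr1 : 0 ≤ t ^ (-(1 / 2 : ℝ)) := Real.rpow_nonneg ht.1.le _
  have hr2 : 0 ≤ (2 * π - t) ^ (-(1 / 2 : ℝ)) := Real.rpow_nonneg (by linarith [ht.2]) _
  rw [div_le_iff₀ hK, sqrtBound]
  rcases le_or_gt t π with htπ | htπ
  · calc lenardDet n t ≤ 2 * Real.exp 1 * Real.sqrt (n + 1) * (Real.sqrt π * t ^ (-(1 / 2 : ℝ))) :=
          lenardDet_le_of_sin n rfl ht.1 htπ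
      _ ≤ 2 * Real.exp 1 * Real.sqrt (n + 1) *
            (Real.sqrt π * (t ^ (-(1 / 2 : ℝ)) + (2 * π - t) ^ (-(1 / 2 : ℝ)))) := by
          gcongr; linarith
      _ = _ := by ring
  · calc lenardDet n t ≤ 2 * Real.exp 1 * Real.sqrt (n + 1) *
            (Real.sqrt π * (2 * π - t) ^ (-(1 / 2 : ℝ))) :=
          lenardDet_le_of_sin n
            (by rw [show (2 * π - t) / 2 = π - t / 2 by ring, Real.sin_pi_sub])
            (by linarith [ht.2]) (by linarith)
      _ ≤ 2 * Real.exp 1 * Real.sqrt (n + 1) *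
            (Real.sqrt π * (t ^ (-(1 / 2 : ℝ)) + (2 * π - t) ^ (-(1 / 2 : ℝ)))) := by
          gcongr; linarith
      _ = _ := by ring

/-- `√n/√(n+1) → 1`. [folklore] -/
theorem tendsto_sqrt_div_sqrt_succ :
    Tendsto (fun n : ℕ => Real.sqrt n / Real.sqrt (n + 1)) atTop (𝓝 1) := by
  have h := tendsto_natCast_div_add_atTop (1 : ℝ)
  have h2 := (Real.continuous_sqrt.tendsto _).comp h
  rw [Real.sqrt_one] at h2
  refine h2.congr fun n => ?_
  simp only [Function.comp_apply]
  rw [Real.sqrt_div' _ (by positivity)]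

/-- Almost every real number is not `2π`. [folklore] -/
theorem ae_ne_two_pi : ∀ᵐ x : ℝ, x ≠ 2 * π := by
  have h := (Set.countable_singleton (2 * π)).ae_notMem (volume : Measure ℝ)
  filter_upwards [h] with x hx
  simpa using hx

/-- **Dominated convergence** under the Fisher–Hartwig fact:
`∫₀^{2π} R(n,t)/√(n+1) dt → ∫₀^{2π} E|e^{it}-1|^{-1/2} dt` (majorant from the Szegő–Lenard bound).
[cite: ClaeysKrasovsky2015, §1 (Lrho0)–(LDy) and Remark 10] -/
theorem tendsto_integral_lenardDet_div_sqrt {E : ℝ}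
    (hpt : ∀ t : ℝ, cexp (t * I) ≠ 1 →
      Tendsto (fun n : ℕ => lenardDet n t / Real.sqrt n) atTop (𝓝 (fhProfile E t))) :
    Tendsto (fun n : ℕ => ∫ t in (0 : ℝ)..2 * π, lenardDet n t / Real.sqrt (n + 1)) atTop
      (𝓝 (∫ t in (0 : ℝ)..2 * π, fhProfile E t)) := by
  have hIoc : Set.uIoc (0 : ℝ) (2 * π) = Set.Ioc 0 (2 * π) := Set.uIoc_of_le (by positivity)
  refine intervalIntegral.tendsto_integral_filter_of_dominated_convergence sqrtBound ?_ ?_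
    intervalIntegrable_sqrtBound ?_
  · exact Eventually.of_forall fun n =>
      ((continuous_lenardDet n).div_const _).aestronglyMeasurable
  · refine Eventually.of_forall fun n => ?_
    filter_upwards [ae_ne_two_pi] with t ht htI
    rw [hIoc] at htI
    have ht' : t ∈ Set.Ioo 0 (2 * π) := ⟨htI.1, lt_of_le_of_ne htI.2 ht⟩
    rw [Real.norm_of_nonneg (div_nonneg (lenardDet_nonneg n t) (Real.sqrt_nonneg _))]
    exact lenardDet_div_sqrt_le_sqrtBound n ht'
  · filter_upwards [ae_ne_two_pi] with t ht htI
    rw [hIoc] at htI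
    have ht' : t ∈ Set.Ioo 0 (2 * π) := ⟨htI.1, lt_of_le_of_ne htI.2 ht⟩
    have hlim := hpt t (cexp_ne_one_of_mem_Ioo ht')
    have hmul := hlim.mul tendsto_sqrt_div_sqrt_succ
    rw [mul_one] at hmul
    refine hmul.congr' ?_
    filter_upwards [eventually_ge_atTop 1] with n hn
    have hn' : (0 : ℝ) < n := by exact_mod_cast hn
    have hs : Real.sqrt n ≠ 0 := (Real.sqrt_pos.2 hn').ne'
    field_simp

/-- The limit profile is integrable on `[0, 2π]`. [folklore] -/
theorem intervalIntegrable_fhProfile {E : ℝ} (hE : 0 ≤ E) :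
    IntervalIntegrable (fhProfile E) volume 0 (2 * π) := by
  have hmeas : Measurable (fhProfile E) := by
    unfold fhProfile
    exact measurable_const.mul ((by fun_prop : Continuous fun t : ℝ => ‖cexp (t * I) - 1‖).measurable.pow_const _)
  have hIoc : Set.uIoc (0 : ℝ) (2 * π) = Set.Ioc 0 (2 * π) := Set.uIoc_of_le (by positivity)
  refine (intervalIntegrable_sqrtBound.const_mul (E / (2 * Real.exp 1))).mono_fun'
    hmeas.aestronglyMeasurable ?_
  rw [Filter.EventuallyLE, ae_restrict_iff' measurableSet_uIoc]
  filter_upwards [ae_ne_two_pi] with t ht htI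
  rw [hIoc] at htI
  have ht' : t ∈ Set.Ioo 0 (2 * π) := ⟨htI.1, lt_of_le_of_ne htI.2 ht⟩
  -- `|e^{it} - 1| = 2 sin(t/2) ≥ 2t'/π` with `t'` the distance to `2πℤ`
  have key : ∀ {u : ℝ}, Real.sin (t / 2) = Real.sin (u / 2) → 0 < u → u ≤ π →
      ‖cexp (t * I) - 1‖ ^ (-(1 / 2 : ℝ)) ≤ Real.sqrt π * u ^ (-(1 / 2 : ℝ)) := by
    intro u hsin hu0 huπ
    have hsin_ge := div_pi_le_sin_half hu0.le huπ
    have hup : 0 < u / π := by positivity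
    have hnorm : ‖cexp (t * I) - 1‖ = 2 * |Real.sin (u / 2)| := by
      rw [← norm_neg, neg_sub, norm_one_sub_cexp, hsin]
    have hpos : 0 < Real.sin (u / 2) := lt_of_lt_of_le hup hsin_ge
    rw [hnorm, abs_of_pos hpos]
    calc (2 * Real.sin (u / 2)) ^ (-(1 / 2 : ℝ)) ≤ (u / π) ^ (-(1 / 2 : ℝ)) :=
          Real.rpow_le_rpow_of_nonpos hup (by linarith) (by norm_num)
      _ = Real.sqrt π * u ^ (-(1 / 2 : ℝ)) := by
          rw [Real.rpow_neg hup.le, Real.rpow_neg hu0.le, ← Real.sqrt_eq_rpow, ← Real.sqrt_eq_rpow,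
            Real.sqrt_div' _ Real.pi_pos.le, inv_div, div_eq_mul_inv]
  have hr1 : 0 ≤ t ^ (-(1 / 2 : ℝ)) := Real.rpow_nonneg ht'.1.le _
  have hr2 : 0 ≤ (2 * π - t) ^ (-(1 / 2 : ℝ)) := Real.rpow_nonneg (by linarith [ht'.2]) _
  rw [Real.norm_of_nonneg (by unfold fhProfile; exact mul_nonneg hE (Real.rpow_nonneg (norm_nonneg _) _)),
    fhProfile, sqrtBound]
  have he : 0 < Real.exp 1 := Real.exp_pos 1
  rcases le_or_gt t π with htπ | htπ
  · have := key rfl ht'.1 htπ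
    calc E * ‖cexp (t * I) - 1‖ ^ (-(1 / 2 : ℝ)) ≤ E * (Real.sqrt π * t ^ (-(1 / 2 : ℝ))) := by gcongr
      _ ≤ E * (Real.sqrt π * (t ^ (-(1 / 2 : ℝ)) + (2 * π - t) ^ (-(1 / 2 : ℝ)))) := by
          gcongr; linarith
      _ = E / (2 * Real.exp 1) * (2 * Real.exp 1 * Real.sqrt π *
            (t ^ (-(1 / 2 : ℝ)) + (2 * π - t) ^ (-(1 / 2 : ℝ)))) := by
          field_simp
  · have := key (u := 2 * π - t)
      (by rw [show (2 * π - t) / 2 = π - t / 2 by ring, Real.sin_pi_sub])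
      (by linarith [ht'.2]) (by linarith)
    calc E * ‖cexp (t * I) - 1‖ ^ (-(1 / 2 : ℝ)) ≤ E * (Real.sqrt π * (2 * π - t) ^ (-(1 / 2 : ℝ))) := by
          gcongr
      _ ≤ E * (Real.sqrt π * (t ^ (-(1 / 2 : ℝ)) + (2 * π - t) ^ (-(1 / 2 : ℝ)))) := by
          gcongr; linarith
      _ = E / (2 * Real.exp 1) * (2 * Real.exp 1 * Real.sqrt π *
            (t ^ (-(1 / 2 : ℝ)) + (2 * π - t) ^ (-(1 / 2 : ℝ)))) := by
          field_simp

/-- **The limit profile has positive mean**: `E |e^{it} - 1|^{-1/2} ≥ E/√2` on `(0, 2π)`, so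
`(2π)⁻¹ ∫₀^{2π} E |e^{it} - 1|^{-1/2} dt ≥ E/√2 > 0`. [folklore] -/
theorem integral_fhProfile_pos {E : ℝ} (hE : 0 < E) :
    0 < (2 * π)⁻¹ * ∫ t in (0 : ℝ)..2 * π, fhProfile E t := by
  have hπ := Real.pi_pos
  have hge : ∀ t ∈ Set.Ioo 0 (2 * π), E / Real.sqrt 2 ≤ fhProfile E t := by
    intro t ht
    have hne := cexp_ne_one_of_mem_Ioo ht
    have hpos : 0 < ‖cexp (t * I) - 1‖ := norm_pos_iff.2 (sub_ne_zero.2 hne)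
    have hle2 : ‖cexp (t * I) - 1‖ ≤ 2 :=
      (norm_sub_le _ _).trans (by rw [norm_exp_ofReal_mul_I, norm_one]; norm_num)
    unfold fhProfile
    rw [div_eq_mul_inv]
    gcongr
    calc (Real.sqrt 2)⁻¹ = (2 : ℝ) ^ (-(1 / 2 : ℝ)) := by
          rw [Real.rpow_neg zero_le_two, ← Real.sqrt_eq_rpow]
      _ ≤ ‖cexp (t * I) - 1‖ ^ (-(1 / 2 : ℝ)) :=
          Real.rpow_le_rpow_of_nonpos hpos hle2 (by norm_num)
  have hmono : ∫ _ in (0 : ℝ)..2 * π, E / Real.sqrt 2 ≤ ∫ t in (0 : ℝ)..2 * π, fhProfile E t :=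
    intervalIntegral.integral_mono_on_of_le_Ioo (by positivity) intervalIntegrable_const
      (intervalIntegrable_fhProfile hE.le) hge
  rw [intervalIntegral.integral_const, sub_zero, smul_eq_mul] at hmono
  have hlow : 0 < 2 * π * (E / Real.sqrt 2) := by positivity
  have := lt_of_lt_of_le hlow hmono
  positivity

end DysonConstant

end Literature.Barriers.AtomisticToContinuum.BoseGas

namespace Literature.Barriers.AtomisticToContinuum

open BoseGas

/-- **Dyson's constant modulo Fisher–Hartwig**: the pointwise Fisher–Hartwig asymptotics of the
Toeplitz determinant of Lenard's symbol — Lenard's conjecture / Widom's theorem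
`D_n(|z-e^{iθ₁}||z-e^{iθ₂}|) = E n^{1/2} |e^{iθ₁}-e^{iθ₂}|^{-1/2} (1+o(1))`, `E = G(3/2)⁴`
[cite: DeiftItsKrasovsky2013, §6 (eq81), (eq83)–(eq85)] [cite: Widom1973, Theorem], taken here as
the HYPOTHESIS `hFH` with the constant existential (it is not in the tree) — imply the printed
sharp law `OneDimensionalHardCoreSqrt`: `c₀(N)/√N → C = (2π)⁻¹ ∫₀^{2π} E |e^{it}-1|^{-1/2} dt > 0`,
by Lenard's formula, the Szegő–Lenard majorant and dominated convergence (the argument of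
[ClaeysKrasovsky2015, §1 (Lrho0)–(LDy)], whose Thm 1.6 / Remark 10 show that the merging window
contributes only `o(√n)`; here that window is controlled by Szegő's inequality instead).
[cite: ClaeysKrasovsky2015, §1 (Lrho0)–(LDy), Thm 1.6 and Remark 10]
[cite: DeiftItsKrasovsky2013, Remark 8] -/
theorem oneDimensionalHardCoreSqrt_of_fisherHartwig
    (hFH : ∃ E : ℝ, 0 < E ∧ ∀ θ₁ θ₂ : ℝ, cexp (θ₁ * I) ≠ cexp (θ₂ * I) →
      Tendsto (fun n : ℕ =>
          toeplitzDet (circleCoeff fun θ : ℝ =>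
              ((‖(cexp (θ * I) - cexp (θ₁ * I)) * (cexp (θ * I) - cexp (θ₂ * I))‖ : ℝ) : ℂ)) n /
            ((Real.sqrt n : ℝ) : ℂ))
        atTop (𝓝 (((E * ‖cexp (θ₁ * I) - cexp (θ₂ * I)‖ ^ (-(1 / 2 : ℝ)) : ℝ) : ℂ)))) :
    OneDimensionalHardCoreSqrt := by
  obtain ⟨E, hE, hX⟩ := hFH
  have hpt : ∀ t : ℝ, cexp (t * I) ≠ 1 →
      Tendsto (fun n : ℕ => lenardDet n t / Real.sqrt n) atTop (𝓝 (fhProfile E t)) :=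
    fun t ht => tendsto_lenardDet_div_sqrt (hX t 0 (by simpa using ht))
  refine ⟨(2 * π)⁻¹ * ∫ t in (0 : ℝ)..2 * π, fhProfile E t, integral_fhProfile_pos hE,
    fun L hL => ?_⟩
  have hT := (tendsto_integral_lenardDet_div_sqrt hpt).const_mul (2 * π)⁻¹
  have hv : Tendsto (fun n : ℕ => zeroMomentumOccupation (n + 1) L / Real.sqrt ((n + 1 : ℕ) : ℝ))
      atTop (𝓝 ((2 * π)⁻¹ * ∫ t in (0 : ℝ)..2 * π, fhProfile E t)) := by
    refine hT.congr fun n => ?_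
    rw [zeroMomentumOccupation_succ_eq_integral hL n, intervalIntegral.integral_div]
    push_cast
    ring
  exact (tendsto_add_atTop_iff_nat (f := fun N : ℕ => zeroMomentumOccupation N L / Real.sqrt N) 1).1 hv

end Literature.Barriers.AtomisticToContinuum

end
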